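import Summits.CriticalPhenomena.PercolationContinuityZ3.Theorems.PercNearOneGluingNoHeavyLowerTailSahiGridPatternWForm
import Summits.CriticalPhenomena.PercolationContinuityZ3.Theorems.PercNearOneGluingNoHeavyLowerTailSahiGridPatternFaces

/-!
# `NoHeavyLowerTail` (crux stmt-CriticalPhenomena-4575), Sahi programme: **THE REMOVAL FORM OF THE UPPER-STEP SLACK AND THE SHADOW THEOREM —
# COMB-M⁺ inside the open core whenever the cost points' shadows in the lowered tops stay inside the meets (every dimension)**

Support file (seat `prim-ineq-gen-4`, generation 14; `--supports stmt-CriticalPhenomena-4575`).  Pure proofs, no definitions, no `sorry`, standard axioms.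
Vocabulary and machinery of `…SahiGridPattern{WForm,Costless,KappaForm,YProfile,Faces,TwoLayerTop,TwoSetsTop,Kleitman,Harris}`.

THE MATHEMATICS.  Upper-step triple `Au, Bu, Cu ⊆ [3]^{n+1}` of up-sets, slices `A⁰ ⊆ A²`, `B⁰ ⊆ B²`, `C⁰ ⊆ C²`, top `τ = (A²,B²,C²)`, increments
`b = B²∖B⁰`, `c = C²∖C⁰`, and the two parts of `W_A = A⁰∩B²C²∖B⁰C⁰` (`…WForm`):
  `T_b := A⁰ ∩ b ∩ C²` (points of the `A`-bottom at which `B` was lowered while lying in the top `C²`),  `T_c := A⁰ ∩ B⁰ ∩ c`.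
Lowering the slots one at a time (the removal calculus of generation 12, read off the W-form) gives the **REMOVAL FORM**
(`four_mul_sStarD_top_add_two_mul_le_removal`):
  `4·sStarD τ + 2·sStarD(A⁰,B²,C²) ≤ sStarD Au Bu Cu + 2·sStarD(A²,C²,T_b) + 2·sStarD(A²,B²,T_c)`,
i.e. in cube language `c₂ − c₃ ≥ c(τ) + c(A,B′,C′) − Σ_{u∈T_b} P_u(A′,C′) − Σ_{u∈T_c} P_u(A′,B′)`: the only COSTS are the y-profiles (`…YProfile`) of the
two other tops at the cost points, and `sStarD(A²,C²,T_b) = Σ_{u∈T_b} yProfile A² C² u` (`sStarD_eq_sum_yProfile`).  Since also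
`sStarD τ = Σ_{y∈B²} yProfile A² C² y` and `sStarD(A⁰,B²,C²) = Σ_{z∈C²} yProfile A⁰ B² z` with `yProfile A⁰ B² ≥ yProfile A² B²` on `T_c`
(`sStarD_first_anti_on_subset`), and the y-profile is `≥ 0` on the meet (`yProfile_nonneg_of_mem`), we get:
* **THE SHADOW THEOREM** (`two_mul_sStarD_top_le_of_upperStep_shadow`, every `n`): let `U_b ⊆ B²` and `U_c ⊆ C²` be sets with `T_b ∩ U_b = ∅`,
  `T_c ∩ U_c = ∅`, `B² ∖ U_b ⊆ A² ∩ C²` and `C² ∖ U_c ⊆ A⁰ ∩ B²` ("the part of each lowered top removed together with the cost points lies in the meet of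
  the other two sets").  If `sStarD(A²,C²,U_b) ≥ 0` and `sStarD(A⁰,B²,U_c) ≥ 0` (instances of `PatternPos n` when `U_b, U_c` are up-sets; unconditional for
  `n ≤ 3`) then COMB-M⁺ holds: **`2·sStarD τ ≤ sStarD Au Bu Cu`**.  The natural choice is `U_b = B² ∖ ↓T_b`, `U_c = C² ∖ ↓T_c` (the tops minus the SHADOWS
  of the cost points), which are up-sets; the hypothesis then reads: every point of `B²` below a cost point of `T_b` lies in `A²∩C²`, and every point of
  `C²` below a point of `T_c` lies in `A⁰∩B²`.
* **THEOREM M** (`two_mul_sStarD_top_le_of_upperStep_minimalCosts`): if every point of `T_b` is a MINIMAL element of `B²` and every point of `T_c` is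
  minimal in `C²`, then `B²∖T_b`, `C²∖T_c` are up-sets and COMB-M⁺ holds given `sStarD(A²,C²,B²∖T_b) ≥ 0`, `sStarD(A⁰,B²,C²∖T_c) ≥ 0`.
These are the first faces INSIDE the open core (all three `W`'s nonempty, comb-`κ₃ < 0`, at least two movers): at `m = 4` the shadow condition holds in
35 831 186 of the 37 206 002 nontrivial (ordered nested triple, axis, profile) cells (96.3 %), 75.9 % of the core cells; `m = 5` sample 80.5 % / 56.1 %
(seat folder `work/comb/shadow2.c`).  Memo: `run/shared/lean/prim/prim-ineq-gen-4/FINDING-W-FORM-g14.md`.  HONEST LABEL: COMB-M⁺ in general, `PatternPos d`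
(`d ≥ 4`), Sahi's `C₃` and Kahn's conjecture remain OPEN; nothing here asserts them. [this work]
-/

namespace Summit.CriticalPhenomena.PercolationContinuityZ3.Theorems.SahiGridPattern

open Finset SahiGrid3
open scoped BigOperators

variable {n : ℕ}

/-- Swapping the first two sets of a Latin count (re-index the pair). [this work] -/
theorem latin_swap_first_two (X Y Z : Finset (Pd n)) :
    (∑ q, ∑ r, ind X q * ind Y r * ind Z (thirdPt q r) * (if TotDist q r = true then (1:ℤ) else 0)) = ∑ q, ∑ r, ind Y q * ind X r * ind Z (thirdPt q r) * (if TotDist q r = true then (1:ℤ) else 0) := by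
  rw [Finset.sum_comm]
  refine Finset.sum_congr rfl fun q _ => Finset.sum_congr rfl fun r _ => ?_
  rw [thirdPt_comm r q, totDist_symm r q]; ring

/-- Pointwise bookkeeping of the removal form (all variables are `0/1`; `a0 ≤ a2`, `b0 ≤ b2`, `c0 ≤ c2`): with `tb = a0(b2−b0)c2`, `tc = a0 b0 (c2−c0)`,
(i) `a0 b2 c2 − a0 b0 c0 = a2 c2 tb + a2 b2 tc`, (ii) `c2 tb + b2 tc ≤ b2 c2 − b0 c0`, (iii) `a2 tb ≤ a0 (b2 − b0)`, (iv) `a2 tc ≤ a0 (c2 − c0)`. [this work] -/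
theorem removal_pointwise (a0 a2 b0 b2 c0 c2 : ℤ) (ha0 : a0 = 0 ∨ a0 = 1) (ha2 : a2 = 0 ∨ a2 = 1) (hb0 : b0 = 0 ∨ b0 = 1) (hb2 : b2 = 0 ∨ b2 = 1)
    (hc0 : c0 = 0 ∨ c0 = 1) (hc2 : c2 = 0 ∨ c2 = 1) (haa : a0 ≤ a2) (hbb : b0 ≤ b2) (hcc : c0 ≤ c2) :
    (a0 * b2 * c2 - a0 * b0 * c0 = a2 * c2 * (a0 * (b2 - b0) * c2) + a2 * b2 * (a0 * b0 * (c2 - c0)))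
    ∧ (c2 * (a0 * (b2 - b0) * c2) + b2 * (a0 * b0 * (c2 - c0)) ≤ b2 * c2 - b0 * c0)
    ∧ (a2 * (a0 * (b2 - b0) * c2) ≤ a0 * (b2 - b0))
    ∧ (a2 * (a0 * b0 * (c2 - c0)) ≤ a0 * (c2 - c0)) := by
  rcases ha0 with rfl | rfl <;> rcases ha2 with rfl | rfl <;> rcases hb0 with rfl | rfl <;> rcases hb2 with rfl | rfl <;>
    rcases hc0 with rfl | rfl <;> rcases hc2 with rfl | rfl <;> refine ⟨?_, ?_, ?_, ?_⟩ <;> omega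

/-- **Anti-monotonicity of `sStarD` in the first set on a third set inside it** (every `n`): for `A⁰ ⊆ A²` and `T ⊆ A⁰ ∩ B`,
`sStarD A² B T ≤ sStarD A⁰ B T` — pointwise `P_u(A⁰,B) − P_u(A²,B) = |a|_u + |a∩B|_u − Λ_u(a,B) ≥ 0` (`a = A²∖A⁰`). [this work] -/
theorem sStarD_first_anti_on_subset {A0 A2 B T : Finset (Pd n)} (hA : A0 ⊆ A2) (hT : T ⊆ A0 ∩ B) :
    sStarD A2 B T ≤ sStarD A0 B T := by
  rw [sStarD_counting A2 B T, sStarD_counting A0 B T]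
  have iT : ∀ p, ind A0 p * ind B p * ind T p = ind T p ∧ ind A2 p * ind B p * ind T p = ind T p ∧ ind B p * ind T p = ind T p ∧ ind A0 p * ind T p = ind T p ∧ ind A2 p * ind T p = ind T p := by
    intro p
    by_cases hp : p ∈ T
    · have h0 : p ∈ A0 := (mem_inter.1 (hT hp)).1
      have hb : p ∈ B := (mem_inter.1 (hT hp)).2
      have h2 : p ∈ A2 := hA h0
      unfold ind; simp [hp, h0, hb, h2]
    · unfold ind; simp [hp]
  have e1 : (∑ p, ind A2 p * ind B p * ind T p) = ∑ p, ind A0 p * ind B p * ind T p :=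
    Finset.sum_congr rfl fun p _ => by rw [(iT p).1, (iT p).2.1]
  have e2 : (∑ p, ∑ q, ind B p * ind A2 q * ind T q * (if TotDist p q = true then (1:ℤ) else 0)) = ∑ p, ∑ q, ind B p * ind A0 q * ind T q * (if TotDist p q = true then (1:ℤ) else 0) :=
    Finset.sum_congr rfl fun p _ => Finset.sum_congr rfl fun q _ => by
      have h1 := (iT q).2.2.2.2
      have h2 := (iT q).2.2.2.1
      linear_combination (ind B p * (if TotDist p q = true then (1:ℤ) else 0)) * h1 - (ind B p * (if TotDist p q = true then (1:ℤ) else 0)) * h2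
  -- the two differences `N(a;B,T)`-type terms are ≥ the Latin difference
  have hsub : ∀ p, 0 ≤ ind A2 p - ind A0 p := fun p => by
    unfold ind; by_cases h0 : p ∈ A0
    · simp [h0, hA h0]
    · by_cases h2 : p ∈ A2 <;> simp [h0, h2]
  -- La ≤ Na : drop `ind B q ≤ 1`, re-index the inner sum
  have La_le : (∑ q, ∑ r, ind B q * ind T r * ind A2 (thirdPt q r) * (if TotDist q r = true then (1:ℤ) else 0)) - (∑ q, ∑ r, ind B q * ind T r * ind A0 (thirdPt q r) * (if TotDist q r = true then (1:ℤ) else 0))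
      ≤ (∑ p, ∑ q, ind A2 p * ind B q * ind T q * (if TotDist p q = true then (1:ℤ) else 0)) - (∑ p, ∑ q, ind A0 p * ind B q * ind T q * (if TotDist p q = true then (1:ℤ) else 0)) := by
    have step1 : (∑ q, ∑ r, ind B q * ind T r * ind A2 (thirdPt q r) * (if TotDist q r = true then (1:ℤ) else 0)) - (∑ q, ∑ r, ind B q * ind T r * ind A0 (thirdPt q r) * (if TotDist q r = true then (1:ℤ) else 0))
        ≤ ∑ q, ∑ r, ind T r * (ind A2 (thirdPt q r) - ind A0 (thirdPt q r)) * (if TotDist q r = true then (1:ℤ) else 0) := by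
      rw [← Finset.sum_sub_distrib]
      refine Finset.sum_le_sum fun q _ => ?_
      rw [← Finset.sum_sub_distrib]
      refine Finset.sum_le_sum fun r _ => ?_
      have hB1 : ind B q ≤ 1 := by unfold ind; split_ifs <;> norm_num
      have hB0 : 0 ≤ ind B q := ind_nonneg' _ _
      have hT0 : 0 ≤ ind T r := ind_nonneg' _ _
      have hd : 0 ≤ (if TotDist q r = true then (1:ℤ) else 0) := by split_ifs <;> norm_num
      have ha := hsub (thirdPt q r)
      nlinarith [mul_nonneg hT0 (mul_nonneg ha hd)]
    have step2 : (∑ q, ∑ r, ind T r * (ind A2 (thirdPt q r) - ind A0 (thirdPt q r)) * (if TotDist q r = true then (1:ℤ) else 0))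
        = ∑ r, ∑ q, ind T r * (ind A2 q - ind A0 q) * (if TotDist r q = true then (1:ℤ) else 0) := by
      rw [Finset.sum_comm]
      refine Finset.sum_congr rfl fun r _ => ?_
      rw [← sum_comp_thirdPt r (fun q => ind T r * (ind A2 q - ind A0 q) * (if TotDist r q = true then (1:ℤ) else 0))]
      refine Finset.sum_congr rfl fun q _ => ?_
      rw [thirdPt_comm q r, totDist_thirdPt_right, totDist_symm q r]
    have step3 : (∑ r, ∑ q, ind T r * (ind A2 q - ind A0 q) * (if TotDist r q = true then (1:ℤ) else 0))
        = (∑ p, ∑ q, ind A2 p * ind B q * ind T q * (if TotDist p q = true then (1:ℤ) else 0)) - (∑ p, ∑ q, ind A0 p * ind B q * ind T q * (if TotDist p q = true then (1:ℤ) else 0)) := by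
      rw [← Finset.sum_sub_distrib, Finset.sum_comm]
      refine Finset.sum_congr rfl fun p _ => ?_
      rw [← Finset.sum_sub_distrib]
      refine Finset.sum_congr rfl fun q _ => ?_
      have h3 := (iT q).2.2.1
      rw [totDist_symm q p]
      linear_combination ((ind A0 p - ind A2 p) * (if TotDist p q = true then (1:ℤ) else 0)) * h3
    linarith [step1, step2.le, step2.ge, step3.le, step3.ge]
  have Na2 : 0 ≤ (∑ p, ∑ q, ind T p * ind A2 q * ind B q * (if TotDist p q = true then (1:ℤ) else 0)) - (∑ p, ∑ q, ind T p * ind A0 q * ind B q * (if TotDist p q = true then (1:ℤ) else 0)) := by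
    rw [← Finset.sum_sub_distrib]
    refine Finset.sum_nonneg fun p _ => ?_
    rw [← Finset.sum_sub_distrib]
    refine Finset.sum_nonneg fun q _ => ?_
    have hT0 : 0 ≤ ind T p := ind_nonneg' _ _
    have hB0 : 0 ≤ ind B q := ind_nonneg' _ _
    have hd : 0 ≤ (if TotDist p q = true then (1:ℤ) else 0) := by split_ifs <;> norm_num
    have ha := hsub q
    have : ind T p * ind A2 q * ind B q * (if TotDist p q = true then (1:ℤ) else 0) - ind T p * ind A0 q * ind B q * (if TotDist p q = true then (1:ℤ) else 0) = ind T p * ((ind A2 q - ind A0 q) * (ind B q * (if TotDist p q = true then (1:ℤ) else 0))) := by ring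
    rw [this]
    exact mul_nonneg hT0 (mul_nonneg ha (mul_nonneg hB0 hd))
  rw [e1, e2]
  linarith [La_le, Na2]

/-- **THE REMOVAL FORM** (every `n`): for an upper-step triple of up-sets,
`4·sStarD τ + 2·sStarD(A⁰,B²,C²) ≤ sStarD Au Bu Cu + 2·sStarD(A²,C²,T_b) + 2·sStarD(A²,B²,T_c)` with the cost sets
`T_b = A⁰ ∩ (B²∖B⁰) ∩ C²`, `T_c = A⁰ ∩ B⁰ ∩ (C²∖C⁰)`: the W-form's negative term `4·2^n·#W_A` is traded for the two y-profile cost sums, the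
difference being five nonnegative brackets (two Kleitman gaps on `b∖T_b`, `c∖T_c`, three monotone pair counts). [this work] -/
theorem four_mul_sStarD_top_add_two_mul_le_removal (Au Bu Cu : Finset (Pd (n + 1)))
    (hA : IsUpperSet (Au : Set (Pd (n + 1)))) (hB : IsUpperSet (Bu : Set (Pd (n + 1)))) (hC : IsUpperSet (Cu : Set (Pd (n + 1))))
    (hAu : ∀ q : Pd n, ind Au (Fin.snoc q 1 : Pd (n + 1)) = ind Au (Fin.snoc q 2 : Pd (n + 1)))
    (hBu : ∀ q : Pd n, ind Bu (Fin.snoc q 1 : Pd (n + 1)) = ind Bu (Fin.snoc q 2 : Pd (n + 1)))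
    (hCu : ∀ q : Pd n, ind Cu (Fin.snoc q 1 : Pd (n + 1)) = ind Cu (Fin.snoc q 2 : Pd (n + 1))) :
    4 * sStarD (univ.filter fun q : Pd n => (Fin.snoc q 2 : Pd (n + 1)) ∈ Au) (univ.filter fun q : Pd n => (Fin.snoc q 2 : Pd (n + 1)) ∈ Bu) (univ.filter fun q : Pd n => (Fin.snoc q 2 : Pd (n + 1)) ∈ Cu) + 2 * sStarD (univ.filter fun q : Pd n => (Fin.snoc q 0 : Pd (n + 1)) ∈ Au) (univ.filter fun q : Pd n => (Fin.snoc q 2 : Pd (n + 1)) ∈ Bu) (univ.filter fun q : Pd n => (Fin.snoc q 2 : Pd (n + 1)) ∈ Cu) ≤ sStarD Au Bu Cu + 2 * sStarD (univ.filter fun q : Pd n => (Fin.snoc q 2 : Pd (n + 1)) ∈ Au) (univ.filter fun q : Pd n => (Fin.snoc q 2 : Pd (n + 1)) ∈ Cu) (((univ.filter fun q : Pd n => (Fin.snoc q 0 : Pd (n + 1)) ∈ Au) ∩ ((univ.filter fun q : Pd n => (Fin.snoc q 2 : Pd (n + 1)) ∈ Bu) \ (univ.filter fun q : Pd n => (Fin.snoc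 q 0 : Pd (n + 1)) ∈ Bu))) ∩ (univ.filter fun q : Pd n => (Fin.snoc q 2 : Pd (n + 1)) ∈ Cu)) + 2 * sStarD (univ.filter fun q : Pd n => (Fin.snoc q 2 : Pd (n + 1)) ∈ Au) (univ.filter fun q : Pd n => (Fin.snoc q 2 : Pd (n + 1)) ∈ Bu) (((univ.filter fun q : Pd n => (Fin.snoc q 0 : Pd (n + 1)) ∈ Au) ∩ (univ.filter fun q : Pd n => (Fin.snoc q 0 : Pd (n + 1)) ∈ Bu)) ∩ ((univ.filter fun q : Pd n => (Fin.snoc q 2 : Pd (n + 1)) ∈ Cu) \ (univ.filter fun q : Pd n => (Fin.snoc q 0 : Pd (n + 1)) ∈ Cu))) := by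
  have eW := sStarD_upperStep_wForm Au Bu Cu hAu hBu hCu
  have eTb := sStarD_counting (univ.filter fun q : Pd n => (Fin.snoc q 2 : Pd (n + 1)) ∈ Au) (univ.filter fun q : Pd n => (Fin.snoc q 2 : Pd (n + 1)) ∈ Cu) (((univ.filter fun q : Pd n => (Fin.snoc q 0 : Pd (n + 1)) ∈ Au) ∩ ((univ.filter fun q : Pd n => (Fin.snoc q 2 : Pd (n + 1)) ∈ Bu) \ (univ.filter fun q : Pd n => (Fin.snoc q 0 : Pd (n + 1)) ∈ Bu))) ∩ (univ.filter fun q : Pd n => (Fin.snoc q 2 : Pd (n + 1)) ∈ Cu))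
  have eTc := sStarD_counting (univ.filter fun q : Pd n => (Fin.snoc q 2 : Pd (n + 1)) ∈ Au) (univ.filter fun q : Pd n => (Fin.snoc q 2 : Pd (n + 1)) ∈ Bu) (((univ.filter fun q : Pd n => (Fin.snoc q 0 : Pd (n + 1)) ∈ Au) ∩ (univ.filter fun q : Pd n => (Fin.snoc q 0 : Pd (n + 1)) ∈ Bu)) ∩ ((univ.filter fun q : Pd n => (Fin.snoc q 2 : Pd (n + 1)) ∈ Cu) \ (univ.filter fun q : Pd n => (Fin.snoc q 0 : Pd (n + 1)) ∈ Cu)))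
  have hA2up : IsUpperSet (((univ.filter fun q : Pd n => (Fin.snoc q 2 : Pd (n + 1)) ∈ Au) : Finset (Pd n)) : Set (Pd n)) := isUpperSet_filter_snoc hA 2
  have hB2up : IsUpperSet (((univ.filter fun q : Pd n => (Fin.snoc q 2 : Pd (n + 1)) ∈ Bu) : Finset (Pd n)) : Set (Pd n)) := isUpperSet_filter_snoc hB 2
  have hC2up : IsUpperSet (((univ.filter fun q : Pd n => (Fin.snoc q 2 : Pd (n + 1)) ∈ Cu) : Finset (Pd n)) : Set (Pd n)) := isUpperSet_filter_snoc hC 2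
  have sB : (univ.filter fun q : Pd n => (Fin.snoc q 0 : Pd (n + 1)) ∈ Bu) ⊆ (univ.filter fun q : Pd n => (Fin.snoc q 2 : Pd (n + 1)) ∈ Bu) := by
    intro q hq
    rw [mem_filter] at hq ⊢
    exact ⟨mem_univ _, hB (snoc_le_snoc_of_le q (by decide : (0:Fin 3) ≤ 2)) hq.2⟩
  have sC : (univ.filter fun q : Pd n => (Fin.snoc q 0 : Pd (n + 1)) ∈ Cu) ⊆ (univ.filter fun q : Pd n => (Fin.snoc q 2 : Pd (n + 1)) ∈ Cu) := by
    intro q hq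
    rw [mem_filter] at hq ⊢
    exact ⟨mem_univ _, hC (snoc_le_snoc_of_le q (by decide : (0:Fin 3) ≤ 2)) hq.2⟩
  have sTb : (((univ.filter fun q : Pd n => (Fin.snoc q 0 : Pd (n + 1)) ∈ Au) ∩ ((univ.filter fun q : Pd n => (Fin.snoc q 2 : Pd (n + 1)) ∈ Bu) \ (univ.filter fun q : Pd n => (Fin.snoc q 0 : Pd (n + 1)) ∈ Bu))) ∩ (univ.filter fun q : Pd n => (Fin.snoc q 2 : Pd (n + 1)) ∈ Cu)) ⊆ (univ.filter fun q : Pd n => (Fin.snoc q 2 : Pd (n + 1)) ∈ Bu) \ (univ.filter fun q : Pd n => (Fin.snoc q 0 : Pd (n + 1)) ∈ Bu) := fun q hq => (mem_inter.1 (mem_inter.1 hq).1).2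
  have sTc : (((univ.filter fun q : Pd n => (Fin.snoc q 0 : Pd (n + 1)) ∈ Au) ∩ (univ.filter fun q : Pd n => (Fin.snoc q 0 : Pd (n + 1)) ∈ Bu)) ∩ ((univ.filter fun q : Pd n => (Fin.snoc q 2 : Pd (n + 1)) ∈ Cu) \ (univ.filter fun q : Pd n => (Fin.snoc q 0 : Pd (n + 1)) ∈ Cu))) ⊆ (univ.filter fun q : Pd n => (Fin.snoc q 2 : Pd (n + 1)) ∈ Cu) \ (univ.filter fun q : Pd n => (Fin.snoc q 0 : Pd (n + 1)) ∈ Cu) := fun q hq => (mem_inter.1 hq).2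
  have nA : ∀ p, ind (univ.filter fun q : Pd n => (Fin.snoc q 0 : Pd (n + 1)) ∈ Au) p ≤ ind (univ.filter fun q : Pd n => (Fin.snoc q 2 : Pd (n + 1)) ∈ Au) p := fun p => by
    rw [ind_filter_snoc, ind_filter_snoc]; exact ind_snoc_mono hA p (by decide)
  have nB : ∀ p, ind (univ.filter fun q : Pd n => (Fin.snoc q 0 : Pd (n + 1)) ∈ Bu) p ≤ ind (univ.filter fun q : Pd n => (Fin.snoc q 2 : Pd (n + 1)) ∈ Bu) p := fun p => by
    rw [ind_filter_snoc, ind_filter_snoc]; exact ind_snoc_mono hB p (by decide)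
  have nC : ∀ p, ind (univ.filter fun q : Pd n => (Fin.snoc q 0 : Pd (n + 1)) ∈ Cu) p ≤ ind (univ.filter fun q : Pd n => (Fin.snoc q 2 : Pd (n + 1)) ∈ Cu) p := fun p => by
    rw [ind_filter_snoc, ind_filter_snoc]; exact ind_snoc_mono hC p (by decide)
  -- indicators of the cost sets
  have iTb : ∀ q, ind (((univ.filter fun q : Pd n => (Fin.snoc q 0 : Pd (n + 1)) ∈ Au) ∩ ((univ.filter fun q : Pd n => (Fin.snoc q 2 : Pd (n + 1)) ∈ Bu) \ (univ.filter fun q : Pd n => (Fin.snoc q 0 : Pd (n + 1)) ∈ Bu))) ∩ (univ.filter fun q : Pd n => (Fin.snoc q 2 : Pd (n + 1)) ∈ Cu)) q = ind (univ.filter fun q : Pd n => (Fin.snoc q 0 : Pd (n + 1)) ∈ Au) q * (ind (univ.filter fun q : Pd n => (Fin.snoc q 2 : Pd (n + 1)) ∈ Bu) q - ind (univ.filter fun q : Pd n => (Fin.snoc q 0 : Pd (n + 1)) ∈ Bu) q) * ind (univ.filter fun q : Pd n => (Fin.snoc q 2 : Pd (n + 1)) ∈ Cu) q := fun q => by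
    rw [ind_inter_eq_mul, ind_inter_eq_mul, ind_sdiff_of_subset sB]
  have iTc : ∀ q, ind (((univ.filter fun q : Pd n => (Fin.snoc q 0 : Pd (n + 1)) ∈ Au) ∩ (univ.filter fun q : Pd n => (Fin.snoc q 0 : Pd (n + 1)) ∈ Bu)) ∩ ((univ.filter fun q : Pd n => (Fin.snoc q 2 : Pd (n + 1)) ∈ Cu) \ (univ.filter fun q : Pd n => (Fin.snoc q 0 : Pd (n + 1)) ∈ Cu))) q = ind (univ.filter fun q : Pd n => (Fin.snoc q 0 : Pd (n + 1)) ∈ Au) q * ind (univ.filter fun q : Pd n => (Fin.snoc q 0 : Pd (n + 1)) ∈ Bu) q * (ind (univ.filter fun q : Pd n => (Fin.snoc q 2 : Pd (n + 1)) ∈ Cu) q - ind (univ.filter fun q : Pd n => (Fin.snoc q 0 : Pd (n + 1)) ∈ Cu) q) := fun q => by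
    rw [ind_inter_eq_mul, ind_inter_eq_mul, ind_sdiff_of_subset sC]
  have PW := fun q => removal_pointwise (ind (univ.filter fun q : Pd n => (Fin.snoc q 0 : Pd (n + 1)) ∈ Au) q) (ind (univ.filter fun q : Pd n => (Fin.snoc q 2 : Pd (n + 1)) ∈ Au) q) (ind (univ.filter fun q : Pd n => (Fin.snoc q 0 : Pd (n + 1)) ∈ Bu) q) (ind (univ.filter fun q : Pd n => (Fin.snoc q 2 : Pd (n + 1)) ∈ Bu) q) (ind (univ.filter fun q : Pd n => (Fin.snoc q 0 : Pd (n + 1)) ∈ Cu) q) (ind (univ.filter fun q : Pd n => (Fin.snoc q 2 : Pd (n + 1)) ∈ Cu) q)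
    (ind_eq_zero_or_one _ _) (ind_eq_zero_or_one _ _) (ind_eq_zero_or_one _ _) (ind_eq_zero_or_one _ _) (ind_eq_zero_or_one _ _) (ind_eq_zero_or_one _ _)
    (nA q) (nB q) (nC q)
  -- (D) the diagonal terms cancel: #W_A = D_b + D_c
  have eD : ((∑ p, ind (univ.filter fun q : Pd n => (Fin.snoc q 0 : Pd (n + 1)) ∈ Au) p * ind (univ.filter fun q : Pd n => (Fin.snoc q 2 : Pd (n + 1)) ∈ Bu) p * ind (univ.filter fun q : Pd n => (Fin.snoc q 2 : Pd (n + 1)) ∈ Cu) p) - (∑ p, ind (univ.filter fun q : Pd n => (Fin.snoc q 0 : Pd (n + 1)) ∈ Au) p * ind (univ.filter fun q : Pd n => (Fin.snoc q 0 : Pd (n + 1)) ∈ Bu) p * ind (univ.filter fun q : Pd n => (Fin.snoc q 0 : Pd (n + 1)) ∈ Cu) p)) = (∑ p, ind (univ.filter fun q : Pd n => (Fin.snoc q 2 : Pd (n + 1)) ∈ Au) p * ind (univ.filter fun q : Pd n => (Fin.snoc q 2 : Pd (n + 1)) ∈ Cu) p * ind (((univ.filter fun q : Pd n => (Fin.snoc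 q 0 : Pd (n + 1)) ∈ Au) ∩ ((univ.filter fun q : Pd n => (Fin.snoc q 2 : Pd (n + 1)) ∈ Bu) \ (univ.filter fun q : Pd n => (Fin.snoc q 0 : Pd (n + 1)) ∈ Bu))) ∩ (univ.filter fun q : Pd n => (Fin.snoc q 2 : Pd (n + 1)) ∈ Cu)) p) + (∑ p, ind (univ.filter fun q : Pd n => (Fin.snoc q 2 : Pd (n + 1)) ∈ Au) p * ind (univ.filter fun q : Pd n => (Fin.snoc q 2 : Pd (n + 1)) ∈ Bu) p * ind (((univ.filter fun q : Pd n => (Fin.snoc q 0 : Pd (n + 1)) ∈ Au) ∩ (univ.filter fun q : Pd n => (Fin.snoc q 0 : Pd (n + 1)) ∈ Bu)) ∩ ((univ.filter fun q : Pd n => (Fin.snoc q 2 : Pd (n + 1)) ∈ Cu) \ (univ.filter fun q : Pd n => (Fin.snoc q 0 : Pd (n + 1)) ∈ Cu))) p) := by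
    rw [← Finset.sum_sub_distrib, ← Finset.sum_add_distrib]
    refine Finset.sum_congr rfl fun p _ => ?_
    rw [iTb p, iTc p]; exact (PW p).1
  -- (Br3) g_A ≥ N_b1 + N_c1
  have Br3 : (∑ p, ∑ q, ind (univ.filter fun q : Pd n => (Fin.snoc q 2 : Pd (n + 1)) ∈ Au) p * ind (univ.filter fun q : Pd n => (Fin.snoc q 2 : Pd (n + 1)) ∈ Cu) q * ind (((univ.filter fun q : Pd n => (Fin.snoc q 0 : Pd (n + 1)) ∈ Au) ∩ ((univ.filter fun q : Pd n => (Fin.snoc q 2 : Pd (n + 1)) ∈ Bu) \ (univ.filter fun q : Pd n => (Fin.snoc q 0 : Pd (n + 1)) ∈ Bu))) ∩ (univ.filter fun q : Pd n => (Fin.snoc q 2 : Pd (n + 1)) ∈ Cu)) q * (if TotDist p q = true then (1:ℤ) else 0)) + (∑ p, ∑ q, ind (univ.filter fun q : Pd n => (Fin.snoc q 2 : Pd (n + 1)) ∈ Au) p * ind (univ.filter fun q : Pd n => (Fin.snoc q 2 : Pd (n + 1)) ∈ Bu) q * ind (((univ.filter fun q : Pd n => (Fin.snoc q 0 : Pd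 (n + 1)) ∈ Au) ∩ (univ.filter fun q : Pd n => (Fin.snoc q 0 : Pd (n + 1)) ∈ Bu)) ∩ ((univ.filter fun q : Pd n => (Fin.snoc q 2 : Pd (n + 1)) ∈ Cu) \ (univ.filter fun q : Pd n => (Fin.snoc q 0 : Pd (n + 1)) ∈ Cu))) q * (if TotDist p q = true then (1:ℤ) else 0)) ≤ ((∑ p, ∑ q, ind (univ.filter fun q : Pd n => (Fin.snoc q 2 : Pd (n + 1)) ∈ Au) p * ind (univ.filter fun q : Pd n => (Fin.snoc q 2 : Pd (n + 1)) ∈ Bu) q * ind (univ.filter fun q : Pd n => (Fin.snoc q 2 : Pd (n + 1)) ∈ Cu) q * (if TotDist p q = true then (1:ℤ) else 0)) - (∑ p, ∑ q, ind (univ.filter fun q : Pd n => (Fin.snoc q 2 : Pd (n + 1)) ∈ Au) p * ind (univ.filter fun q : Pd n => (Fin.snoc q 0 : Pd (n + 1)) ∈ Bu) q * ind (univ.filter fun q : Pd n => (Fin.snoc q 0 : Pd (n + 1)) ∈ Cu) q * (if TotDist p q = true then (1:ℤ) else 0))) := by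
    rw [← Finset.sum_add_distrib, ← Finset.sum_sub_distrib]
    refine Finset.sum_le_sum fun p _ => ?_
    rw [← Finset.sum_add_distrib, ← Finset.sum_sub_distrib]
    refine Finset.sum_le_sum fun q _ => ?_
    rw [iTb q, iTc q]
    have h := (PW q).2.1
    have hp : 0 ≤ ind (univ.filter fun q : Pd n => (Fin.snoc q 2 : Pd (n + 1)) ∈ Au) p := ind_nonneg' _ _
    have hd : 0 ≤ (if TotDist p q = true then (1:ℤ) else 0) := by split_ifs <;> norm_num
    have key := mul_le_mul_of_nonneg_left (mul_le_mul_of_nonneg_right h hd) hp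
    have e1 : ind (univ.filter fun q : Pd n => (Fin.snoc q 2 : Pd (n + 1)) ∈ Au) p * ind (univ.filter fun q : Pd n => (Fin.snoc q 2 : Pd (n + 1)) ∈ Cu) q * (ind (univ.filter fun q : Pd n => (Fin.snoc q 0 : Pd (n + 1)) ∈ Au) q * (ind (univ.filter fun q : Pd n => (Fin.snoc q 2 : Pd (n + 1)) ∈ Bu) q - ind (univ.filter fun q : Pd n => (Fin.snoc q 0 : Pd (n + 1)) ∈ Bu) q) * ind (univ.filter fun q : Pd n => (Fin.snoc q 2 : Pd (n + 1)) ∈ Cu) q) * (if TotDist p q = true then (1:ℤ) else 0) + ind (univ.filter fun q : Pd n => (Fin.snoc q 2 : Pd (n + 1)) ∈ Au) p * ind (univ.filter fun q : Pd n => (Fin.snoc q 2 : Pd (n + 1)) ∈ Bu) q * (ind (univ.filter fun q : Pd n => (Fin.snoc q 0 : Pd (n + 1)) ∈ Au) q * ind (univ.filter fun q : Pd n => (Fin.snoc q 0 : Pd (n + 1)) ∈ Bu) q * (ind (univ.filter fun q : Pd n => (Fin.snoc q 2 : Pd (n + 1)) ∈ Cu) q - ind (univ.filter fun q : Pd n =>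 (Fin.snoc q 0 : Pd (n + 1)) ∈ Cu) q)) * (if TotDist p q = true then (1:ℤ) else 0)
        = ind (univ.filter fun q : Pd n => (Fin.snoc q 2 : Pd (n + 1)) ∈ Au) p * ((ind (univ.filter fun q : Pd n => (Fin.snoc q 2 : Pd (n + 1)) ∈ Cu) q * (ind (univ.filter fun q : Pd n => (Fin.snoc q 0 : Pd (n + 1)) ∈ Au) q * (ind (univ.filter fun q : Pd n => (Fin.snoc q 2 : Pd (n + 1)) ∈ Bu) q - ind (univ.filter fun q : Pd n => (Fin.snoc q 0 : Pd (n + 1)) ∈ Bu) q) * ind (univ.filter fun q : Pd n => (Fin.snoc q 2 : Pd (n + 1)) ∈ Cu) q) + ind (univ.filter fun q : Pd n => (Fin.snoc q 2 : Pd (n + 1)) ∈ Bu) q * (ind (univ.filter fun q : Pd n => (Fin.snoc q 0 : Pd (n + 1)) ∈ Au) q * ind (univ.filter fun q : Pd n => (Fin.snoc q 0 : Pd (n + 1)) ∈ Bu) q * (ind (univ.filter fun q : Pd n => (Fin.snoc q 2 : Pd (n + 1)) ∈ Cu) q - ind (univ.filter fun q : Pd n => (Fin.snoc q 0 : Pd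 (n + 1)) ∈ Cu) q))) * (if TotDist p q = true then (1:ℤ) else 0)) := by ring
    have e2 : ind (univ.filter fun q : Pd n => (Fin.snoc q 2 : Pd (n + 1)) ∈ Au) p * ind (univ.filter fun q : Pd n => (Fin.snoc q 2 : Pd (n + 1)) ∈ Bu) q * ind (univ.filter fun q : Pd n => (Fin.snoc q 2 : Pd (n + 1)) ∈ Cu) q * (if TotDist p q = true then (1:ℤ) else 0) - ind (univ.filter fun q : Pd n => (Fin.snoc q 2 : Pd (n + 1)) ∈ Au) p * ind (univ.filter fun q : Pd n => (Fin.snoc q 0 : Pd (n + 1)) ∈ Bu) q * ind (univ.filter fun q : Pd n => (Fin.snoc q 0 : Pd (n + 1)) ∈ Cu) q * (if TotDist p q = true then (1:ℤ) else 0)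
        = ind (univ.filter fun q : Pd n => (Fin.snoc q 2 : Pd (n + 1)) ∈ Au) p * ((ind (univ.filter fun q : Pd n => (Fin.snoc q 2 : Pd (n + 1)) ∈ Bu) q * ind (univ.filter fun q : Pd n => (Fin.snoc q 2 : Pd (n + 1)) ∈ Cu) q - ind (univ.filter fun q : Pd n => (Fin.snoc q 0 : Pd (n + 1)) ∈ Bu) q * ind (univ.filter fun q : Pd n => (Fin.snoc q 0 : Pd (n + 1)) ∈ Cu) q) * (if TotDist p q = true then (1:ℤ) else 0)) := by ring
    rw [e1, e2]; exact key
  -- (Br4) g_C ≥ N_b2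
  have Br4 : (∑ p, ∑ q, ind (univ.filter fun q : Pd n => (Fin.snoc q 2 : Pd (n + 1)) ∈ Cu) p * ind (univ.filter fun q : Pd n => (Fin.snoc q 2 : Pd (n + 1)) ∈ Au) q * ind (((univ.filter fun q : Pd n => (Fin.snoc q 0 : Pd (n + 1)) ∈ Au) ∩ ((univ.filter fun q : Pd n => (Fin.snoc q 2 : Pd (n + 1)) ∈ Bu) \ (univ.filter fun q : Pd n => (Fin.snoc q 0 : Pd (n + 1)) ∈ Bu))) ∩ (univ.filter fun q : Pd n => (Fin.snoc q 2 : Pd (n + 1)) ∈ Cu)) q * (if TotDist p q = true then (1:ℤ) else 0)) ≤ ((∑ p, ∑ q, ind (univ.filter fun q : Pd n => (Fin.snoc q 2 : Pd (n + 1)) ∈ Cu) p * ind (univ.filter fun q : Pd n => (Fin.snoc q 0 : Pd (n + 1)) ∈ Au) q * ind (univ.filter fun q : Pd n => (Fin.snoc q 2 : Pd (n + 1)) ∈ Bu) q * (if TotDist p q = true then (1:ℤ) else 0)) - (∑ p, ∑ q, ind (univ.filter fun q : Pd n => (Fin.snoc q 2 : Pd (n + 1)) ∈ Cu) p * ind (univ.filter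 fun q : Pd n => (Fin.snoc q 0 : Pd (n + 1)) ∈ Au) q * ind (univ.filter fun q : Pd n => (Fin.snoc q 0 : Pd (n + 1)) ∈ Bu) q * (if TotDist p q = true then (1:ℤ) else 0))) := by
    rw [← Finset.sum_sub_distrib]
    refine Finset.sum_le_sum fun p _ => ?_
    rw [← Finset.sum_sub_distrib]
    refine Finset.sum_le_sum fun q _ => ?_
    rw [iTb q]
    have h := (PW q).2.2.1
    have hp : 0 ≤ ind (univ.filter fun q : Pd n => (Fin.snoc q 2 : Pd (n + 1)) ∈ Cu) p := ind_nonneg' _ _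
    have hd : 0 ≤ (if TotDist p q = true then (1:ℤ) else 0) := by split_ifs <;> norm_num
    have key := mul_le_mul_of_nonneg_left (mul_le_mul_of_nonneg_right h hd) hp
    have e1 : ind (univ.filter fun q : Pd n => (Fin.snoc q 2 : Pd (n + 1)) ∈ Cu) p * ind (univ.filter fun q : Pd n => (Fin.snoc q 2 : Pd (n + 1)) ∈ Au) q * (ind (univ.filter fun q : Pd n => (Fin.snoc q 0 : Pd (n + 1)) ∈ Au) q * (ind (univ.filter fun q : Pd n => (Fin.snoc q 2 : Pd (n + 1)) ∈ Bu) q - ind (univ.filter fun q : Pd n => (Fin.snoc q 0 : Pd (n + 1)) ∈ Bu) q) * ind (univ.filter fun q : Pd n => (Fin.snoc q 2 : Pd (n + 1)) ∈ Cu) q) * (if TotDist p q = true then (1:ℤ) else 0) = ind (univ.filter fun q : Pd n => (Fin.snoc q 2 : Pd (n + 1)) ∈ Cu) p * (ind (univ.filter fun q : Pd n => (Fin.snoc q 2 : Pd (n + 1)) ∈ Au) q * (ind (univ.filter fun q : Pd n => (Fin.snoc q 0 : Pd (n + 1)) ∈ Au) q * (ind (univ.filter fun q : Pd n => (Fin.snoc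 q 2 : Pd (n + 1)) ∈ Bu) q - ind (univ.filter fun q : Pd n => (Fin.snoc q 0 : Pd (n + 1)) ∈ Bu) q) * ind (univ.filter fun q : Pd n => (Fin.snoc q 2 : Pd (n + 1)) ∈ Cu) q) * (if TotDist p q = true then (1:ℤ) else 0)) := by ring
    have e2 : ind (univ.filter fun q : Pd n => (Fin.snoc q 2 : Pd (n + 1)) ∈ Cu) p * ind (univ.filter fun q : Pd n => (Fin.snoc q 0 : Pd (n + 1)) ∈ Au) q * ind (univ.filter fun q : Pd n => (Fin.snoc q 2 : Pd (n + 1)) ∈ Bu) q * (if TotDist p q = true then (1:ℤ) else 0) - ind (univ.filter fun q : Pd n => (Fin.snoc q 2 : Pd (n + 1)) ∈ Cu) p * ind (univ.filter fun q : Pd n => (Fin.snoc q 0 : Pd (n + 1)) ∈ Au) q * ind (univ.filter fun q : Pd n => (Fin.snoc q 0 : Pd (n + 1)) ∈ Bu) q * (if TotDist p q = true then (1:ℤ) else 0) = ind (univ.filter fun q : Pd n => (Fin.snoc q 2 : Pd (n + 1)) ∈ Cu) p * (ind (univ.filter fun q : Pd n => (Fin.snoc q 0 : Pd (n + 1)) ∈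 Au) q * (ind (univ.filter fun q : Pd n => (Fin.snoc q 2 : Pd (n + 1)) ∈ Bu) q - ind (univ.filter fun q : Pd n => (Fin.snoc q 0 : Pd (n + 1)) ∈ Bu) q) * (if TotDist p q = true then (1:ℤ) else 0)) := by ring
    rw [e1, e2]; exact key
  -- (Br5) g_B ≥ N_c2
  have Br5 : (∑ p, ∑ q, ind (univ.filter fun q : Pd n => (Fin.snoc q 2 : Pd (n + 1)) ∈ Bu) p * ind (univ.filter fun q : Pd n => (Fin.snoc q 2 : Pd (n + 1)) ∈ Au) q * ind (((univ.filter fun q : Pd n => (Fin.snoc q 0 : Pd (n + 1)) ∈ Au) ∩ (univ.filter fun q : Pd n => (Fin.snoc q 0 : Pd (n + 1)) ∈ Bu)) ∩ ((univ.filter fun q : Pd n => (Fin.snoc q 2 : Pd (n + 1)) ∈ Cu) \ (univ.filter fun q : Pd n => (Fin.snoc q 0 : Pd (n + 1)) ∈ Cu))) q * (if TotDist p q = true then (1:ℤ) else 0)) ≤ ((∑ p, ∑ q, ind (univ.filter fun q : Pd n => (Fin.snoc q 2 : Pd (n + 1)) ∈ Bu) p * ind (univ.filter fun q : Pd n =>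 (Fin.snoc q 0 : Pd (n + 1)) ∈ Au) q * ind (univ.filter fun q : Pd n => (Fin.snoc q 2 : Pd (n + 1)) ∈ Cu) q * (if TotDist p q = true then (1:ℤ) else 0)) - (∑ p, ∑ q, ind (univ.filter fun q : Pd n => (Fin.snoc q 2 : Pd (n + 1)) ∈ Bu) p * ind (univ.filter fun q : Pd n => (Fin.snoc q 0 : Pd (n + 1)) ∈ Au) q * ind (univ.filter fun q : Pd n => (Fin.snoc q 0 : Pd (n + 1)) ∈ Cu) q * (if TotDist p q = true then (1:ℤ) else 0))) := by
    rw [← Finset.sum_sub_distrib]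
    refine Finset.sum_le_sum fun p _ => ?_
    rw [← Finset.sum_sub_distrib]
    refine Finset.sum_le_sum fun q _ => ?_
    rw [iTc q]
    have h := (PW q).2.2.2
    have hp : 0 ≤ ind (univ.filter fun q : Pd n => (Fin.snoc q 2 : Pd (n + 1)) ∈ Bu) p := ind_nonneg' _ _
    have hd : 0 ≤ (if TotDist p q = true then (1:ℤ) else 0) := by split_ifs <;> norm_num
    have key := mul_le_mul_of_nonneg_left (mul_le_mul_of_nonneg_right h hd) hp
    have e1 : ind (univ.filter fun q : Pd n => (Fin.snoc q 2 : Pd (n + 1)) ∈ Bu) p * ind (univ.filter fun q : Pd n => (Fin.snoc q 2 : Pd (n + 1)) ∈ Au) q * (ind (univ.filter fun q : Pd n => (Fin.snoc q 0 : Pd (n + 1)) ∈ Au) q * ind (univ.filter fun q : Pd n => (Fin.snoc q 0 : Pd (n + 1)) ∈ Bu) q * (ind (univ.filter fun q : Pd n => (Fin.snoc q 2 : Pd (n + 1)) ∈ Cu) q - ind (univ.filter fun q : Pd n => (Fin.snoc q 0 : Pd (n + 1)) ∈ Cu) q)) * (if TotDist p q = true then (1:ℤ) else 0) = ind (univ.filter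 fun q : Pd n => (Fin.snoc q 2 : Pd (n + 1)) ∈ Bu) p * (ind (univ.filter fun q : Pd n => (Fin.snoc q 2 : Pd (n + 1)) ∈ Au) q * (ind (univ.filter fun q : Pd n => (Fin.snoc q 0 : Pd (n + 1)) ∈ Au) q * ind (univ.filter fun q : Pd n => (Fin.snoc q 0 : Pd (n + 1)) ∈ Bu) q * (ind (univ.filter fun q : Pd n => (Fin.snoc q 2 : Pd (n + 1)) ∈ Cu) q - ind (univ.filter fun q : Pd n => (Fin.snoc q 0 : Pd (n + 1)) ∈ Cu) q)) * (if TotDist p q = true then (1:ℤ) else 0)) := by ring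
    have e2 : ind (univ.filter fun q : Pd n => (Fin.snoc q 2 : Pd (n + 1)) ∈ Bu) p * ind (univ.filter fun q : Pd n => (Fin.snoc q 0 : Pd (n + 1)) ∈ Au) q * ind (univ.filter fun q : Pd n => (Fin.snoc q 2 : Pd (n + 1)) ∈ Cu) q * (if TotDist p q = true then (1:ℤ) else 0) - ind (univ.filter fun q : Pd n => (Fin.snoc q 2 : Pd (n + 1)) ∈ Bu) p * ind (univ.filter fun q : Pd n => (Fin.snoc q 0 : Pd (n + 1)) ∈ Au) q * ind (univ.filter fun q : Pd n => (Fin.snoc q 0 : Pd (n + 1)) ∈ Cu) q * (if TotDist p q = true then (1:ℤ) else 0) = ind (univ.filter fun q : Pd n => (Fin.snoc q 2 : Pd (n + 1)) ∈ Bu) p * (ind (univ.filter fun q : Pd n => (Fin.snoc q 0 : Pd (n + 1)) ∈ Au) q * (ind (univ.filter fun q : Pd n => (Fin.snoc q 2 : Pd (n + 1)) ∈ Cu) q - ind (univ.filter fun q : Pd n => (Fin.snoc q 0 : Pd (n + 1)) ∈ Cu) q) * (if TotDist p q = true then (1:ℤ) else 0)) := by ring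
    rw [e1, e2]; exact key
  -- (Br1) Kleitman on b ∖ T_b :  [N(b;A²,C²) − N(T_b;A²,C²)] − [L(A²;b,C²) − L(A²;T_b,C²)] ≥ 0
  have Br1 : 0 ≤ ((∑ p, ∑ q, ind (univ.filter fun q : Pd n => (Fin.snoc q 2 : Pd (n + 1)) ∈ Bu) p * ind (univ.filter fun q : Pd n => (Fin.snoc q 2 : Pd (n + 1)) ∈ Au) q * ind (univ.filter fun q : Pd n => (Fin.snoc q 2 : Pd (n + 1)) ∈ Cu) q * (if TotDist p q = true then (1:ℤ) else 0)) - (∑ p, ∑ q, ind (univ.filter fun q : Pd n => (Fin.snoc q 0 : Pd (n + 1)) ∈ Bu) p * ind (univ.filter fun q : Pd n => (Fin.snoc q 2 : Pd (n + 1)) ∈ Au) q * ind (univ.filter fun q : Pd n => (Fin.snoc q 2 : Pd (n + 1)) ∈ Cu) q * (if TotDist p q = true then (1:ℤ) else 0)) - (∑ p, ∑ q, ind (((univ.filter fun q : Pd n => (Fin.snoc q 0 : Pd (n + 1)) ∈ Au) ∩ ((univ.filter fun q : Pd n => (Fin.snoc q 2 : Pd (n + 1)) ∈ Bu) \ (univ.filter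 fun q : Pd n => (Fin.snoc q 0 : Pd (n + 1)) ∈ Bu))) ∩ (univ.filter fun q : Pd n => (Fin.snoc q 2 : Pd (n + 1)) ∈ Cu)) p * ind (univ.filter fun q : Pd n => (Fin.snoc q 2 : Pd (n + 1)) ∈ Au) q * ind (univ.filter fun q : Pd n => (Fin.snoc q 2 : Pd (n + 1)) ∈ Cu) q * (if TotDist p q = true then (1:ℤ) else 0))) - ((∑ q, ∑ r, ind (univ.filter fun q : Pd n => (Fin.snoc q 2 : Pd (n + 1)) ∈ Bu) q * ind (univ.filter fun q : Pd n => (Fin.snoc q 2 : Pd (n + 1)) ∈ Cu) r * ind (univ.filter fun q : Pd n => (Fin.snoc q 2 : Pd (n + 1)) ∈ Au) (thirdPt q r) * (if TotDist q r = true then (1:ℤ) else 0)) - (∑ q, ∑ r, ind (univ.filter fun q : Pd n => (Fin.snoc q 0 : Pd (n + 1)) ∈ Bu) q * ind (univ.filter fun q : Pd n => (Fin.snoc q 2 : Pd (n + 1)) ∈ Cu) r * ind (univ.filter fun q : Pd n => (Fin.snoc q 2 : Pd (n + 1)) ∈ Au) (thirdPt q r) * (if TotDist q r = true then (1:ℤ)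 else 0)) - (∑ q, ∑ r, ind (((univ.filter fun q : Pd n => (Fin.snoc q 0 : Pd (n + 1)) ∈ Au) ∩ ((univ.filter fun q : Pd n => (Fin.snoc q 2 : Pd (n + 1)) ∈ Bu) \ (univ.filter fun q : Pd n => (Fin.snoc q 0 : Pd (n + 1)) ∈ Bu))) ∩ (univ.filter fun q : Pd n => (Fin.snoc q 2 : Pd (n + 1)) ∈ Cu)) q * ind (univ.filter fun q : Pd n => (Fin.snoc q 2 : Pd (n + 1)) ∈ Cu) r * ind (univ.filter fun q : Pd n => (Fin.snoc q 2 : Pd (n + 1)) ∈ Au) (thirdPt q r) * (if TotDist q r = true then (1:ℤ) else 0))) := by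
    have K0 := sum_ind_lat_le_td (((univ.filter fun q : Pd n => (Fin.snoc q 2 : Pd (n + 1)) ∈ Bu) \ (univ.filter fun q : Pd n => (Fin.snoc q 0 : Pd (n + 1)) ∈ Bu)) \ (((univ.filter fun q : Pd n => (Fin.snoc q 0 : Pd (n + 1)) ∈ Au) ∩ ((univ.filter fun q : Pd n => (Fin.snoc q 2 : Pd (n + 1)) ∈ Bu) \ (univ.filter fun q : Pd n => (Fin.snoc q 0 : Pd (n + 1)) ∈ Bu))) ∩ (univ.filter fun q : Pd n => (Fin.snoc q 2 : Pd (n + 1)) ∈ Cu))) hC2up hA2up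
    have iU : ∀ q, ind (((univ.filter fun q : Pd n => (Fin.snoc q 2 : Pd (n + 1)) ∈ Bu) \ (univ.filter fun q : Pd n => (Fin.snoc q 0 : Pd (n + 1)) ∈ Bu)) \ (((univ.filter fun q : Pd n => (Fin.snoc q 0 : Pd (n + 1)) ∈ Au) ∩ ((univ.filter fun q : Pd n => (Fin.snoc q 2 : Pd (n + 1)) ∈ Bu) \ (univ.filter fun q : Pd n => (Fin.snoc q 0 : Pd (n + 1)) ∈ Bu))) ∩ (univ.filter fun q : Pd n => (Fin.snoc q 2 : Pd (n + 1)) ∈ Cu))) q = ind (univ.filter fun q : Pd n => (Fin.snoc q 2 : Pd (n + 1)) ∈ Bu) q - ind (univ.filter fun q : Pd n => (Fin.snoc q 0 : Pd (n + 1)) ∈ Bu) q - ind (((univ.filter fun q : Pd n => (Fin.snoc q 0 : Pd (n + 1)) ∈ Au) ∩ ((univ.filter fun q : Pd n => (Fin.snoc q 2 : Pd (n + 1)) ∈ Bu) \ (univ.filter fun q : Pd n => (Fin.snoc q 0 : Pd (n + 1)) ∈ Bu))) ∩ (univ.filter fun q : Pd n => (Fin.snoc q 2 : Pd (n + 1))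 ∈ Cu)) q := fun q => by
      rw [ind_sdiff_of_subset sTb, ind_sdiff_of_subset sB]
    have e1 : (∑ p, ∑ q, ind (((univ.filter fun q : Pd n => (Fin.snoc q 2 : Pd (n + 1)) ∈ Bu) \ (univ.filter fun q : Pd n => (Fin.snoc q 0 : Pd (n + 1)) ∈ Bu)) \ (((univ.filter fun q : Pd n => (Fin.snoc q 0 : Pd (n + 1)) ∈ Au) ∩ ((univ.filter fun q : Pd n => (Fin.snoc q 2 : Pd (n + 1)) ∈ Bu) \ (univ.filter fun q : Pd n => (Fin.snoc q 0 : Pd (n + 1)) ∈ Bu))) ∩ (univ.filter fun q : Pd n => (Fin.snoc q 2 : Pd (n + 1)) ∈ Cu))) p * ind (univ.filter fun q : Pd n => (Fin.snoc q 2 : Pd (n + 1)) ∈ Cu) q * ind (univ.filter fun q : Pd n => (Fin.snoc q 2 : Pd (n + 1)) ∈ Au) (thirdPt p q) * (if TotDist p q = true then (1:ℤ) else 0)) =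
        (∑ q, ∑ r, ind (univ.filter fun q : Pd n => (Fin.snoc q 2 : Pd (n + 1)) ∈ Bu) q * ind (univ.filter fun q : Pd n => (Fin.snoc q 2 : Pd (n + 1)) ∈ Cu) r * ind (univ.filter fun q : Pd n => (Fin.snoc q 2 : Pd (n + 1)) ∈ Au) (thirdPt q r) * (if TotDist q r = true then (1:ℤ) else 0)) - (∑ q, ∑ r, ind (univ.filter fun q : Pd n => (Fin.snoc q 0 : Pd (n + 1)) ∈ Bu) q * ind (univ.filter fun q : Pd n => (Fin.snoc q 2 : Pd (n + 1)) ∈ Cu) r * ind (univ.filter fun q : Pd n => (Fin.snoc q 2 : Pd (n + 1)) ∈ Au) (thirdPt q r) * (if TotDist q r = true then (1:ℤ) else 0)) - (∑ q, ∑ r, ind (((univ.filter fun q : Pd n => (Fin.snoc q 0 : Pd (n + 1)) ∈ Au) ∩ ((univ.filter fun q : Pd n => (Fin.snoc q 2 : Pd (n + 1)) ∈ Bu) \ (univ.filter fun q : Pd n => (Fin.snoc q 0 : Pd (n + 1)) ∈ Bu))) ∩ (univ.filter fun q : Pd n => (Fin.snoc q 2 : Pd (n + 1)) ∈ Cu))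 q * ind (univ.filter fun q : Pd n => (Fin.snoc q 2 : Pd (n + 1)) ∈ Cu) r * ind (univ.filter fun q : Pd n => (Fin.snoc q 2 : Pd (n + 1)) ∈ Au) (thirdPt q r) * (if TotDist q r = true then (1:ℤ) else 0)) := by
      rw [← Finset.sum_sub_distrib, ← Finset.sum_sub_distrib]
      refine Finset.sum_congr rfl fun p _ => ?_
      rw [← Finset.sum_sub_distrib, ← Finset.sum_sub_distrib]
      refine Finset.sum_congr rfl fun q _ => ?_
      rw [iU p]; ring
    have e2 : (∑ p, ∑ q, ind (((univ.filter fun q : Pd n => (Fin.snoc q 2 : Pd (n + 1)) ∈ Bu) \ (univ.filter fun q : Pd n => (Fin.snoc q 0 : Pd (n + 1)) ∈ Bu)) \ (((univ.filter fun q : Pd n => (Fin.snoc q 0 : Pd (n + 1)) ∈ Au) ∩ ((univ.filter fun q : Pd n => (Fin.snoc q 2 : Pd (n + 1)) ∈ Bu) \ (univ.filter fun q : Pd n => (Fin.snoc q 0 : Pd (n + 1)) ∈ Bu))) ∩ (univ.filter fun q : Pd n => (Fin.snoc q 2 : Pd (n + 1)) ∈ Cu))) p * ind (univ.filter fun q :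 Pd n => (Fin.snoc q 2 : Pd (n + 1)) ∈ Cu) q * ind (univ.filter fun q : Pd n => (Fin.snoc q 2 : Pd (n + 1)) ∈ Au) q * (if TotDist p q = true then (1:ℤ) else 0)) =
        (∑ p, ∑ q, ind (univ.filter fun q : Pd n => (Fin.snoc q 2 : Pd (n + 1)) ∈ Bu) p * ind (univ.filter fun q : Pd n => (Fin.snoc q 2 : Pd (n + 1)) ∈ Au) q * ind (univ.filter fun q : Pd n => (Fin.snoc q 2 : Pd (n + 1)) ∈ Cu) q * (if TotDist p q = true then (1:ℤ) else 0)) - (∑ p, ∑ q, ind (univ.filter fun q : Pd n => (Fin.snoc q 0 : Pd (n + 1)) ∈ Bu) p * ind (univ.filter fun q : Pd n => (Fin.snoc q 2 : Pd (n + 1)) ∈ Au) q * ind (univ.filter fun q : Pd n => (Fin.snoc q 2 : Pd (n + 1)) ∈ Cu) q * (if TotDist p q = true then (1:ℤ) else 0)) - (∑ p, ∑ q, ind (((univ.filter fun q : Pd n => (Fin.snoc q 0 : Pd (n + 1)) ∈ Au) ∩ ((univ.filter fun q : Pd n => (Fin.snoc q 2 : Pd (n + 1)) ∈ Bu) \ (univ.filter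 fun q : Pd n => (Fin.snoc q 0 : Pd (n + 1)) ∈ Bu))) ∩ (univ.filter fun q : Pd n => (Fin.snoc q 2 : Pd (n + 1)) ∈ Cu)) p * ind (univ.filter fun q : Pd n => (Fin.snoc q 2 : Pd (n + 1)) ∈ Au) q * ind (univ.filter fun q : Pd n => (Fin.snoc q 2 : Pd (n + 1)) ∈ Cu) q * (if TotDist p q = true then (1:ℤ) else 0)) := by
      rw [← Finset.sum_sub_distrib, ← Finset.sum_sub_distrib]
      refine Finset.sum_congr rfl fun p _ => ?_
      rw [← Finset.sum_sub_distrib, ← Finset.sum_sub_distrib]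
      refine Finset.sum_congr rfl fun q _ => ?_
      rw [iU p]; ring
    rw [e1, e2] at K0
    linarith
  -- (Br2) Kleitman on c ∖ T_c (c sits at the second Latin index in Θ_C: swap)
  have Br2 : 0 ≤ ((∑ p, ∑ q, ind (univ.filter fun q : Pd n => (Fin.snoc q 2 : Pd (n + 1)) ∈ Cu) p * ind (univ.filter fun q : Pd n => (Fin.snoc q 2 : Pd (n + 1)) ∈ Au) q * ind (univ.filter fun q : Pd n => (Fin.snoc q 2 : Pd (n + 1)) ∈ Bu) q * (if TotDist p q = true then (1:ℤ) else 0)) - (∑ p, ∑ q, ind (univ.filter fun q : Pd n => (Fin.snoc q 0 : Pd (n + 1)) ∈ Cu) p * ind (univ.filter fun q : Pd n => (Fin.snoc q 2 : Pd (n + 1)) ∈ Au) q * ind (univ.filter fun q : Pd n => (Fin.snoc q 2 : Pd (n + 1)) ∈ Bu) q * (if TotDist p q = true then (1:ℤ) else 0)) - (∑ p, ∑ q, ind (((univ.filter fun q : Pd n => (Fin.snoc q 0 : Pd (n + 1)) ∈ Au) ∩ (univ.filter fun q : Pd n => (Fin.snoc q 0 : Pd (n + 1)) ∈ Bu)) ∩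 ((univ.filter fun q : Pd n => (Fin.snoc q 2 : Pd (n + 1)) ∈ Cu) \ (univ.filter fun q : Pd n => (Fin.snoc q 0 : Pd (n + 1)) ∈ Cu))) p * ind (univ.filter fun q : Pd n => (Fin.snoc q 2 : Pd (n + 1)) ∈ Au) q * ind (univ.filter fun q : Pd n => (Fin.snoc q 2 : Pd (n + 1)) ∈ Bu) q * (if TotDist p q = true then (1:ℤ) else 0))) - ((∑ q, ∑ r, ind (univ.filter fun q : Pd n => (Fin.snoc q 2 : Pd (n + 1)) ∈ Bu) q * ind (univ.filter fun q : Pd n => (Fin.snoc q 2 : Pd (n + 1)) ∈ Cu) r * ind (univ.filter fun q : Pd n => (Fin.snoc q 2 : Pd (n + 1)) ∈ Au) (thirdPt q r) * (if TotDist q r = true then (1:ℤ) else 0)) - (∑ q, ∑ r, ind (univ.filter fun q : Pd n => (Fin.snoc q 2 : Pd (n + 1)) ∈ Bu) q * ind (univ.filter fun q : Pd n => (Fin.snoc q 0 : Pd (n + 1)) ∈ Cu) r * ind (univ.filter fun q : Pd n => (Fin.snoc q 2 : Pd (n + 1)) ∈ Au) (thirdPt q r) * (if TotDist q r = true then (1:ℤ)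 else 0)) - (∑ q, ∑ r, ind (((univ.filter fun q : Pd n => (Fin.snoc q 0 : Pd (n + 1)) ∈ Au) ∩ (univ.filter fun q : Pd n => (Fin.snoc q 0 : Pd (n + 1)) ∈ Bu)) ∩ ((univ.filter fun q : Pd n => (Fin.snoc q 2 : Pd (n + 1)) ∈ Cu) \ (univ.filter fun q : Pd n => (Fin.snoc q 0 : Pd (n + 1)) ∈ Cu))) q * ind (univ.filter fun q : Pd n => (Fin.snoc q 2 : Pd (n + 1)) ∈ Bu) r * ind (univ.filter fun q : Pd n => (Fin.snoc q 2 : Pd (n + 1)) ∈ Au) (thirdPt q r) * (if TotDist q r = true then (1:ℤ) else 0))) := by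
    have K0 := sum_ind_lat_le_td (((univ.filter fun q : Pd n => (Fin.snoc q 2 : Pd (n + 1)) ∈ Cu) \ (univ.filter fun q : Pd n => (Fin.snoc q 0 : Pd (n + 1)) ∈ Cu)) \ (((univ.filter fun q : Pd n => (Fin.snoc q 0 : Pd (n + 1)) ∈ Au) ∩ (univ.filter fun q : Pd n => (Fin.snoc q 0 : Pd (n + 1)) ∈ Bu)) ∩ ((univ.filter fun q : Pd n => (Fin.snoc q 2 : Pd (n + 1)) ∈ Cu) \ (univ.filter fun q : Pd n => (Fin.snoc q 0 : Pd (n + 1)) ∈ Cu)))) hB2up hA2up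
    have iU : ∀ q, ind (((univ.filter fun q : Pd n => (Fin.snoc q 2 : Pd (n + 1)) ∈ Cu) \ (univ.filter fun q : Pd n => (Fin.snoc q 0 : Pd (n + 1)) ∈ Cu)) \ (((univ.filter fun q : Pd n => (Fin.snoc q 0 : Pd (n + 1)) ∈ Au) ∩ (univ.filter fun q : Pd n => (Fin.snoc q 0 : Pd (n + 1)) ∈ Bu)) ∩ ((univ.filter fun q : Pd n => (Fin.snoc q 2 : Pd (n + 1)) ∈ Cu) \ (univ.filter fun q : Pd n => (Fin.snoc q 0 : Pd (n + 1)) ∈ Cu)))) q = ind (univ.filter fun q : Pd n => (Fin.snoc q 2 : Pd (n + 1)) ∈ Cu) q - ind (univ.filter fun q : Pd n => (Fin.snoc q 0 : Pd (n + 1)) ∈ Cu) q - ind (((univ.filter fun q : Pd n => (Fin.snoc q 0 : Pd (n + 1)) ∈ Au) ∩ (univ.filter fun q : Pd n => (Fin.snoc q 0 : Pd (n + 1)) ∈ Bu)) ∩ ((univ.filter fun q : Pd n => (Fin.snoc q 2 : Pd (n + 1)) ∈ Cu) \ (univ.filter fun q : Pd n => (Fin.snoc q 0 : Pd (n + 1))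 ∈ Cu))) q := fun q => by
      rw [ind_sdiff_of_subset sTc, ind_sdiff_of_subset sC]
    have sw2 := latin_swap_first_two (univ.filter fun q : Pd n => (Fin.snoc q 2 : Pd (n + 1)) ∈ Bu) (univ.filter fun q : Pd n => (Fin.snoc q 2 : Pd (n + 1)) ∈ Cu) (univ.filter fun q : Pd n => (Fin.snoc q 2 : Pd (n + 1)) ∈ Au)
    have sw0 := latin_swap_first_two (univ.filter fun q : Pd n => (Fin.snoc q 2 : Pd (n + 1)) ∈ Bu) (univ.filter fun q : Pd n => (Fin.snoc q 0 : Pd (n + 1)) ∈ Cu) (univ.filter fun q : Pd n => (Fin.snoc q 2 : Pd (n + 1)) ∈ Au)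
    have e1 : (∑ p, ∑ q, ind (((univ.filter fun q : Pd n => (Fin.snoc q 2 : Pd (n + 1)) ∈ Cu) \ (univ.filter fun q : Pd n => (Fin.snoc q 0 : Pd (n + 1)) ∈ Cu)) \ (((univ.filter fun q : Pd n => (Fin.snoc q 0 : Pd (n + 1)) ∈ Au) ∩ (univ.filter fun q : Pd n => (Fin.snoc q 0 : Pd (n + 1)) ∈ Bu)) ∩ ((univ.filter fun q : Pd n => (Fin.snoc q 2 : Pd (n + 1)) ∈ Cu) \ (univ.filter fun q : Pd n => (Fin.snoc q 0 : Pd (n + 1)) ∈ Cu)))) p * ind (univ.filter fun q : Pd n => (Fin.snoc q 2 : Pd (n + 1)) ∈ Bu) q * ind (univ.filter fun q : Pd n => (Fin.snoc q 2 : Pd (n + 1)) ∈ Au) (thirdPt p q) * (if TotDist p q = true then (1:ℤ) else 0)) =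
        (∑ q, ∑ r, ind (univ.filter fun q : Pd n => (Fin.snoc q 2 : Pd (n + 1)) ∈ Cu) q * ind (univ.filter fun q : Pd n => (Fin.snoc q 2 : Pd (n + 1)) ∈ Bu) r * ind (univ.filter fun q : Pd n => (Fin.snoc q 2 : Pd (n + 1)) ∈ Au) (thirdPt q r) * (if TotDist q r = true then (1:ℤ) else 0)) - (∑ q, ∑ r, ind (univ.filter fun q : Pd n => (Fin.snoc q 0 : Pd (n + 1)) ∈ Cu) q * ind (univ.filter fun q : Pd n => (Fin.snoc q 2 : Pd (n + 1)) ∈ Bu) r * ind (univ.filter fun q : Pd n => (Fin.snoc q 2 : Pd (n + 1)) ∈ Au) (thirdPt q r) * (if TotDist q r = true then (1:ℤ) else 0)) - (∑ q, ∑ r, ind (((univ.filter fun q : Pd n => (Fin.snoc q 0 : Pd (n + 1)) ∈ Au) ∩ (univ.filter fun q : Pd n => (Fin.snoc q 0 : Pd (n + 1)) ∈ Bu)) ∩ ((univ.filter fun q : Pd n => (Fin.snoc q 2 : Pd (n + 1)) ∈ Cu) \ (univ.filter fun q : Pd n => (Fin.snoc q 0 : Pd (n + 1)) ∈ Cu)))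 q * ind (univ.filter fun q : Pd n => (Fin.snoc q 2 : Pd (n + 1)) ∈ Bu) r * ind (univ.filter fun q : Pd n => (Fin.snoc q 2 : Pd (n + 1)) ∈ Au) (thirdPt q r) * (if TotDist q r = true then (1:ℤ) else 0)) := by
      rw [← Finset.sum_sub_distrib, ← Finset.sum_sub_distrib]
      refine Finset.sum_congr rfl fun p _ => ?_
      rw [← Finset.sum_sub_distrib, ← Finset.sum_sub_distrib]
      refine Finset.sum_congr rfl fun q _ => ?_
      rw [iU p]; ring
    have e2 : (∑ p, ∑ q, ind (((univ.filter fun q : Pd n => (Fin.snoc q 2 : Pd (n + 1)) ∈ Cu) \ (univ.filter fun q : Pd n => (Fin.snoc q 0 : Pd (n + 1)) ∈ Cu)) \ (((univ.filter fun q : Pd n => (Fin.snoc q 0 : Pd (n + 1)) ∈ Au) ∩ (univ.filter fun q : Pd n => (Fin.snoc q 0 : Pd (n + 1)) ∈ Bu)) ∩ ((univ.filter fun q : Pd n => (Fin.snoc q 2 : Pd (n + 1)) ∈ Cu) \ (univ.filter fun q : Pd n => (Fin.snoc q 0 : Pd (n + 1)) ∈ Cu)))) p * ind (univ.filter fun q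 : Pd n => (Fin.snoc q 2 : Pd (n + 1)) ∈ Bu) q * ind (univ.filter fun q : Pd n => (Fin.snoc q 2 : Pd (n + 1)) ∈ Au) q * (if TotDist p q = true then (1:ℤ) else 0)) =
        (∑ p, ∑ q, ind (univ.filter fun q : Pd n => (Fin.snoc q 2 : Pd (n + 1)) ∈ Cu) p * ind (univ.filter fun q : Pd n => (Fin.snoc q 2 : Pd (n + 1)) ∈ Au) q * ind (univ.filter fun q : Pd n => (Fin.snoc q 2 : Pd (n + 1)) ∈ Bu) q * (if TotDist p q = true then (1:ℤ) else 0)) - (∑ p, ∑ q, ind (univ.filter fun q : Pd n => (Fin.snoc q 0 : Pd (n + 1)) ∈ Cu) p * ind (univ.filter fun q : Pd n => (Fin.snoc q 2 : Pd (n + 1)) ∈ Au) q * ind (univ.filter fun q : Pd n => (Fin.snoc q 2 : Pd (n + 1)) ∈ Bu) q * (if TotDist p q = true then (1:ℤ) else 0)) - (∑ p, ∑ q, ind (((univ.filter fun q : Pd n => (Fin.snoc q 0 : Pd (n + 1)) ∈ Au) ∩ (univ.filter fun q : Pd n => (Fin.snoc q 0 : Pd (n + 1)) ∈ Bu)) ∩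 ((univ.filter fun q : Pd n => (Fin.snoc q 2 : Pd (n + 1)) ∈ Cu) \ (univ.filter fun q : Pd n => (Fin.snoc q 0 : Pd (n + 1)) ∈ Cu))) p * ind (univ.filter fun q : Pd n => (Fin.snoc q 2 : Pd (n + 1)) ∈ Au) q * ind (univ.filter fun q : Pd n => (Fin.snoc q 2 : Pd (n + 1)) ∈ Bu) q * (if TotDist p q = true then (1:ℤ) else 0)) := by
      rw [← Finset.sum_sub_distrib, ← Finset.sum_sub_distrib]
      refine Finset.sum_congr rfl fun p _ => ?_
      rw [← Finset.sum_sub_distrib, ← Finset.sum_sub_distrib]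
      refine Finset.sum_congr rfl fun q _ => ?_
      rw [iU p]; ring
    rw [e1, e2] at K0
    rw [sw2, sw0]
    linarith
  -- the Latin terms of the two counting forms, swapped into first-index form
  have eLb : (∑ q, ∑ r, ind (univ.filter fun q : Pd n => (Fin.snoc q 2 : Pd (n + 1)) ∈ Cu) q * ind (((univ.filter fun q : Pd n => (Fin.snoc q 0 : Pd (n + 1)) ∈ Au) ∩ ((univ.filter fun q : Pd n => (Fin.snoc q 2 : Pd (n + 1)) ∈ Bu) \ (univ.filter fun q : Pd n => (Fin.snoc q 0 : Pd (n + 1)) ∈ Bu))) ∩ (univ.filter fun q : Pd n => (Fin.snoc q 2 : Pd (n + 1)) ∈ Cu)) r * ind (univ.filter fun q : Pd n => (Fin.snoc q 2 : Pd (n + 1)) ∈ Au) (thirdPt q r) * (if TotDist q r = true then (1:ℤ) else 0)) = (∑ q, ∑ r, ind (((univ.filter fun q : Pd n => (Fin.snoc q 0 : Pd (n + 1)) ∈ Au) ∩ ((univ.filter fun q : Pd n => (Fin.snoc q 2 : Pd (n + 1)) ∈ Bu) \ (univ.filter fun q : Pd n => (Fin.snoc q 0 : Pd (n + 1)) ∈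 Bu))) ∩ (univ.filter fun q : Pd n => (Fin.snoc q 2 : Pd (n + 1)) ∈ Cu)) q * ind (univ.filter fun q : Pd n => (Fin.snoc q 2 : Pd (n + 1)) ∈ Cu) r * ind (univ.filter fun q : Pd n => (Fin.snoc q 2 : Pd (n + 1)) ∈ Au) (thirdPt q r) * (if TotDist q r = true then (1:ℤ) else 0)) := latin_swap_first_two (univ.filter fun q : Pd n => (Fin.snoc q 2 : Pd (n + 1)) ∈ Cu) (((univ.filter fun q : Pd n => (Fin.snoc q 0 : Pd (n + 1)) ∈ Au) ∩ ((univ.filter fun q : Pd n => (Fin.snoc q 2 : Pd (n + 1)) ∈ Bu) \ (univ.filter fun q : Pd n => (Fin.snoc q 0 : Pd (n + 1)) ∈ Bu))) ∩ (univ.filter fun q : Pd n => (Fin.snoc q 2 : Pd (n + 1)) ∈ Cu)) (univ.filter fun q : Pd n => (Fin.snoc q 2 : Pd (n + 1)) ∈ Au)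
  have eLc : (∑ q, ∑ r, ind (univ.filter fun q : Pd n => (Fin.snoc q 2 : Pd (n + 1)) ∈ Bu) q * ind (((univ.filter fun q : Pd n => (Fin.snoc q 0 : Pd (n + 1)) ∈ Au) ∩ (univ.filter fun q : Pd n => (Fin.snoc q 0 : Pd (n + 1)) ∈ Bu)) ∩ ((univ.filter fun q : Pd n => (Fin.snoc q 2 : Pd (n + 1)) ∈ Cu) \ (univ.filter fun q : Pd n => (Fin.snoc q 0 : Pd (n + 1)) ∈ Cu))) r * ind (univ.filter fun q : Pd n => (Fin.snoc q 2 : Pd (n + 1)) ∈ Au) (thirdPt q r) * (if TotDist q r = true then (1:ℤ) else 0)) = (∑ q, ∑ r, ind (((univ.filter fun q : Pd n => (Fin.snoc q 0 : Pd (n + 1)) ∈ Au) ∩ (univ.filter fun q : Pd n => (Fin.snoc q 0 : Pd (n + 1)) ∈ Bu)) ∩ ((univ.filter fun q : Pd n => (Fin.snoc q 2 : Pd (n + 1)) ∈ Cu) \ (univ.filter fun q : Pd n => (Fin.snoc q 0 : Pd (n + 1)) ∈ Cu))) q * ind (univ.filter fun q : Pd n => (Fin.snoc q 2 : Pd (n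 + 1)) ∈ Bu) r * ind (univ.filter fun q : Pd n => (Fin.snoc q 2 : Pd (n + 1)) ∈ Au) (thirdPt q r) * (if TotDist q r = true then (1:ℤ) else 0)) := latin_swap_first_two (univ.filter fun q : Pd n => (Fin.snoc q 2 : Pd (n + 1)) ∈ Bu) (((univ.filter fun q : Pd n => (Fin.snoc q 0 : Pd (n + 1)) ∈ Au) ∩ (univ.filter fun q : Pd n => (Fin.snoc q 0 : Pd (n + 1)) ∈ Bu)) ∩ ((univ.filter fun q : Pd n => (Fin.snoc q 2 : Pd (n + 1)) ∈ Cu) \ (univ.filter fun q : Pd n => (Fin.snoc q 0 : Pd (n + 1)) ∈ Cu))) (univ.filter fun q : Pd n => (Fin.snoc q 2 : Pd (n + 1)) ∈ Au)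
  rw [eLb] at eTb
  rw [eLc] at eTc
  rw [eD] at eW
  -- diagonal terms of the costs: A²C²T_b = T_b... keep as D_b, D_c (they appear in eW after eD and in eTb/eTc identically)
  have eDb : (∑ p, ind (univ.filter fun q : Pd n => (Fin.snoc q 2 : Pd (n + 1)) ∈ Au) p * ind (univ.filter fun q : Pd n => (Fin.snoc q 2 : Pd (n + 1)) ∈ Cu) p * ind (((univ.filter fun q : Pd n => (Fin.snoc q 0 : Pd (n + 1)) ∈ Au) ∩ ((univ.filter fun q : Pd n => (Fin.snoc q 2 : Pd (n + 1)) ∈ Bu) \ (univ.filter fun q : Pd n => (Fin.snoc q 0 : Pd (n + 1)) ∈ Bu))) ∩ (univ.filter fun q : Pd n => (Fin.snoc q 2 : Pd (n + 1)) ∈ Cu)) p) = (∑ p, ind (univ.filter fun q : Pd n => (Fin.snoc q 2 : Pd (n + 1)) ∈ Au) p * ind (univ.filter fun q : Pd n => (Fin.snoc q 2 : Pd (n + 1)) ∈ Cu) p * ind (((univ.filter fun q : Pd n => (Fin.snoc q 0 : Pd (n + 1)) ∈ Au) ∩ ((univ.filter fun q : Pd n => (Fin.snoc q 2 : Pd (n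 + 1)) ∈ Bu) \ (univ.filter fun q : Pd n => (Fin.snoc q 0 : Pd (n + 1)) ∈ Bu))) ∩ (univ.filter fun q : Pd n => (Fin.snoc q 2 : Pd (n + 1)) ∈ Cu)) p) := rfl
  linarith [eW, eTb, eTc, Br1, Br2, Br3, Br4, Br5]

/-- **THE SHADOW THEOREM** (every `n`): COMB-M⁺ `2·sStarD τ ≤ sStarD υ` for an upper-step triple of up-sets, provided sets `U_b ⊆ B²`, `U_c ⊆ C²` avoiding
the cost sets `T_b`, `T_c` are given such that `B² ∖ U_b ⊆ A² ∩ C²`, `C² ∖ U_c ⊆ A⁰ ∩ B²` (the removed parts — the shadows of the cost points — lie in the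
meets, where the y-profile is nonnegative) and the two functionals `sStarD(A²,C²,U_b)`, `sStarD(A⁰,B²,U_c)` are nonnegative (`PatternPos n` when `U_b, U_c`
are up-sets).  Proof: removal form; `sStarD τ = sStarD(A²,C²,U_b) + Σ_{B²∖U_b} yProfile ≥ Σ_{T_b} yProfile = sStarD(A²,C²,T_b)`, and likewise
`sStarD(A⁰,B²,C²) ≥ sStarD(A⁰,B²,T_c) ≥ sStarD(A²,B²,T_c)`. [this work] -/
theorem two_mul_sStarD_top_le_of_upperStep_shadow (Au Bu Cu : Finset (Pd (n + 1))) (Ub Uc : Finset (Pd n))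
    (hA : IsUpperSet (Au : Set (Pd (n + 1)))) (hB : IsUpperSet (Bu : Set (Pd (n + 1)))) (hC : IsUpperSet (Cu : Set (Pd (n + 1))))
    (hAu : ∀ q : Pd n, ind Au (Fin.snoc q 1 : Pd (n + 1)) = ind Au (Fin.snoc q 2 : Pd (n + 1)))
    (hBu : ∀ q : Pd n, ind Bu (Fin.snoc q 1 : Pd (n + 1)) = ind Bu (Fin.snoc q 2 : Pd (n + 1)))
    (hCu : ∀ q : Pd n, ind Cu (Fin.snoc q 1 : Pd (n + 1)) = ind Cu (Fin.snoc q 2 : Pd (n + 1)))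
    (hUb : Ub ⊆ (univ.filter fun q : Pd n => (Fin.snoc q 2 : Pd (n + 1)) ∈ Bu)) (hUc : Uc ⊆ (univ.filter fun q : Pd n => (Fin.snoc q 2 : Pd (n + 1)) ∈ Cu))
    (hTbU : ∀ q, q ∈ (((univ.filter fun q : Pd n => (Fin.snoc q 0 : Pd (n + 1)) ∈ Au) ∩ ((univ.filter fun q : Pd n => (Fin.snoc q 2 : Pd (n + 1)) ∈ Bu) \ (univ.filter fun q : Pd n => (Fin.snoc q 0 : Pd (n + 1)) ∈ Bu))) ∩ (univ.filter fun q : Pd n => (Fin.snoc q 2 : Pd (n + 1)) ∈ Cu)) → q ∉ Ub) (hTcU : ∀ q, q ∈ (((univ.filter fun q : Pd n => (Fin.snoc q 0 : Pd (n + 1)) ∈ Au) ∩ (univ.filter fun q : Pd n => (Fin.snoc q 0 : Pd (n + 1)) ∈ Bu)) ∩ ((univ.filter fun q : Pd n => (Fin.snoc q 2 : Pd (n + 1)) ∈ Cu) \ (univ.filter fun q : Pd n => (Fin.snoc q 0 : Pd (n + 1)) ∈ Cu))) → q ∉ Uc)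
    (hshB : ∀ q, q ∈ (univ.filter fun q : Pd n => (Fin.snoc q 2 : Pd (n + 1)) ∈ Bu) → q ∉ Ub → q ∈ (univ.filter fun q : Pd n => (Fin.snoc q 2 : Pd (n + 1)) ∈ Au) ∩ (univ.filter fun q : Pd n => (Fin.snoc q 2 : Pd (n + 1)) ∈ Cu))
    (hshC : ∀ q, q ∈ (univ.filter fun q : Pd n => (Fin.snoc q 2 : Pd (n + 1)) ∈ Cu) → q ∉ Uc → q ∈ (univ.filter fun q : Pd n => (Fin.snoc q 0 : Pd (n + 1)) ∈ Au) ∩ (univ.filter fun q : Pd n => (Fin.snoc q 2 : Pd (n + 1)) ∈ Bu))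
    (h1 : 0 ≤ sStarD (univ.filter fun q : Pd n => (Fin.snoc q 2 : Pd (n + 1)) ∈ Au) (univ.filter fun q : Pd n => (Fin.snoc q 2 : Pd (n + 1)) ∈ Cu) Ub) (h2 : 0 ≤ sStarD (univ.filter fun q : Pd n => (Fin.snoc q 0 : Pd (n + 1)) ∈ Au) (univ.filter fun q : Pd n => (Fin.snoc q 2 : Pd (n + 1)) ∈ Bu) Uc) :
    2 * sStarD (univ.filter fun q : Pd n => (Fin.snoc q 2 : Pd (n + 1)) ∈ Au) (univ.filter fun q : Pd n => (Fin.snoc q 2 : Pd (n + 1)) ∈ Bu) (univ.filter fun q : Pd n => (Fin.snoc q 2 : Pd (n + 1)) ∈ Cu) ≤ sStarD Au Bu Cu := by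
  have hR := four_mul_sStarD_top_add_two_mul_le_removal Au Bu Cu hA hB hC hAu hBu hCu
  have sA : (univ.filter fun q : Pd n => (Fin.snoc q 0 : Pd (n + 1)) ∈ Au) ⊆ (univ.filter fun q : Pd n => (Fin.snoc q 2 : Pd (n + 1)) ∈ Au) := by
    intro q hq
    rw [mem_filter] at hq ⊢
    exact ⟨mem_univ _, hA (snoc_le_snoc_of_le q (by decide : (0:Fin 3) ≤ 2)) hq.2⟩
  -- cost_b ≤ sStarD τ
  have cb : sStarD (univ.filter fun q : Pd n => (Fin.snoc q 2 : Pd (n + 1)) ∈ Au) (univ.filter fun q : Pd n => (Fin.snoc q 2 : Pd (n + 1)) ∈ Cu) (((univ.filter fun q : Pd n => (Fin.snoc q 0 : Pd (n + 1)) ∈ Au) ∩ ((univ.filter fun q : Pd n => (Fin.snoc q 2 : Pd (n + 1)) ∈ Bu) \ (univ.filter fun q : Pd n => (Fin.snoc q 0 : Pd (n + 1)) ∈ Bu))) ∩ (univ.filter fun q : Pd n => (Fin.snoc q 2 : Pd (n + 1)) ∈ Cu)) + sStarD (univ.filter fun q : Pd n => (Fin.snoc q 2 : Pd (n + 1)) ∈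 Au) (univ.filter fun q : Pd n => (Fin.snoc q 2 : Pd (n + 1)) ∈ Cu) Ub ≤ sStarD (univ.filter fun q : Pd n => (Fin.snoc q 2 : Pd (n + 1)) ∈ Au) (univ.filter fun q : Pd n => (Fin.snoc q 2 : Pd (n + 1)) ∈ Bu) (univ.filter fun q : Pd n => (Fin.snoc q 2 : Pd (n + 1)) ∈ Cu) := by
    rw [sStarD_swap23 (univ.filter fun q : Pd n => (Fin.snoc q 2 : Pd (n + 1)) ∈ Au) (univ.filter fun q : Pd n => (Fin.snoc q 2 : Pd (n + 1)) ∈ Bu) (univ.filter fun q : Pd n => (Fin.snoc q 2 : Pd (n + 1)) ∈ Cu), sStarD_eq_sum_yProfile, sStarD_eq_sum_yProfile, sStarD_eq_sum_yProfile,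
      ← Finset.sum_sdiff hUb]
    have hsub : (((univ.filter fun q : Pd n => (Fin.snoc q 0 : Pd (n + 1)) ∈ Au) ∩ ((univ.filter fun q : Pd n => (Fin.snoc q 2 : Pd (n + 1)) ∈ Bu) \ (univ.filter fun q : Pd n => (Fin.snoc q 0 : Pd (n + 1)) ∈ Bu))) ∩ (univ.filter fun q : Pd n => (Fin.snoc q 2 : Pd (n + 1)) ∈ Cu)) ⊆ (univ.filter fun q : Pd n => (Fin.snoc q 2 : Pd (n + 1)) ∈ Bu) \ Ub := fun q hq => mem_sdiff.2 ⟨(mem_sdiff.1 ((mem_inter.1 (mem_inter.1 hq).1).2)).1, hTbU q hq⟩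
    have hle := Finset.sum_le_sum_of_subset_of_nonneg hsub (f := fun y => yProfile (univ.filter fun q : Pd n => (Fin.snoc q 2 : Pd (n + 1)) ∈ Au) (univ.filter fun q : Pd n => (Fin.snoc q 2 : Pd (n + 1)) ∈ Cu) y)
      (fun y hy _ => yProfile_nonneg_of_mem (hshB y (mem_sdiff.1 hy).1 (mem_sdiff.1 hy).2))
    linarith
  -- cost_c ≤ sStarD(A⁰,B²,C²)
  have sB : (univ.filter fun q : Pd n => (Fin.snoc q 0 : Pd (n + 1)) ∈ Bu) ⊆ (univ.filter fun q : Pd n => (Fin.snoc q 2 : Pd (n + 1)) ∈ Bu) := by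
    intro q hq
    rw [mem_filter] at hq ⊢
    exact ⟨mem_univ _, hB (snoc_le_snoc_of_le q (by decide : (0:Fin 3) ≤ 2)) hq.2⟩
  have cc : sStarD (univ.filter fun q : Pd n => (Fin.snoc q 2 : Pd (n + 1)) ∈ Au) (univ.filter fun q : Pd n => (Fin.snoc q 2 : Pd (n + 1)) ∈ Bu) (((univ.filter fun q : Pd n => (Fin.snoc q 0 : Pd (n + 1)) ∈ Au) ∩ (univ.filter fun q : Pd n => (Fin.snoc q 0 : Pd (n + 1)) ∈ Bu)) ∩ ((univ.filter fun q : Pd n => (Fin.snoc q 2 : Pd (n + 1)) ∈ Cu) \ (univ.filter fun q : Pd n => (Fin.snoc q 0 : Pd (n + 1)) ∈ Cu))) + sStarD (univ.filter fun q : Pd n => (Fin.snoc q 0 : Pd (n + 1)) ∈ Au) (univ.filter fun q : Pd n => (Fin.snoc q 2 : Pd (n + 1)) ∈ Bu) Uc ≤ sStarD (univ.filter fun q : Pd n => (Fin.snoc q 0 : Pd (n + 1)) ∈ Au) (univ.filter fun q : Pd n => (Fin.snoc q 2 : Pd (n + 1)) ∈ Bu) (univ.filter fun q : Pd n => (Fin.snoc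 q 2 : Pd (n + 1)) ∈ Cu) := by
    have hTc : (((univ.filter fun q : Pd n => (Fin.snoc q 0 : Pd (n + 1)) ∈ Au) ∩ (univ.filter fun q : Pd n => (Fin.snoc q 0 : Pd (n + 1)) ∈ Bu)) ∩ ((univ.filter fun q : Pd n => (Fin.snoc q 2 : Pd (n + 1)) ∈ Cu) \ (univ.filter fun q : Pd n => (Fin.snoc q 0 : Pd (n + 1)) ∈ Cu))) ⊆ (univ.filter fun q : Pd n => (Fin.snoc q 0 : Pd (n + 1)) ∈ Au) ∩ (univ.filter fun q : Pd n => (Fin.snoc q 2 : Pd (n + 1)) ∈ Bu) :=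
      fun q hq => mem_inter.2 ⟨(mem_inter.1 (mem_inter.1 hq).1).1, sB (mem_inter.1 (mem_inter.1 hq).1).2⟩
    have mono := sStarD_first_anti_on_subset sA hTc
    have hsub : (((univ.filter fun q : Pd n => (Fin.snoc q 0 : Pd (n + 1)) ∈ Au) ∩ (univ.filter fun q : Pd n => (Fin.snoc q 0 : Pd (n + 1)) ∈ Bu)) ∩ ((univ.filter fun q : Pd n => (Fin.snoc q 2 : Pd (n + 1)) ∈ Cu) \ (univ.filter fun q : Pd n => (Fin.snoc q 0 : Pd (n + 1)) ∈ Cu))) ⊆ (univ.filter fun q : Pd n => (Fin.snoc q 2 : Pd (n + 1)) ∈ Cu) \ Uc := fun q hq => mem_sdiff.2 ⟨(mem_sdiff.1 (mem_inter.1 hq).2).1, hTcU q hq⟩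
    have e0 : sStarD (univ.filter fun q : Pd n => (Fin.snoc q 0 : Pd (n + 1)) ∈ Au) (univ.filter fun q : Pd n => (Fin.snoc q 2 : Pd (n + 1)) ∈ Bu) (((univ.filter fun q : Pd n => (Fin.snoc q 0 : Pd (n + 1)) ∈ Au) ∩ (univ.filter fun q : Pd n => (Fin.snoc q 0 : Pd (n + 1)) ∈ Bu)) ∩ ((univ.filter fun q : Pd n => (Fin.snoc q 2 : Pd (n + 1)) ∈ Cu) \ (univ.filter fun q : Pd n => (Fin.snoc q 0 : Pd (n + 1)) ∈ Cu))) = ∑ y ∈ (((univ.filter fun q : Pd n => (Fin.snoc q 0 : Pd (n + 1)) ∈ Au) ∩ (univ.filter fun q : Pd n => (Fin.snoc q 0 : Pd (n + 1)) ∈ Bu)) ∩ ((univ.filter fun q : Pd n => (Fin.snoc q 2 : Pd (n + 1)) ∈ Cu) \ (univ.filter fun q : Pd n => (Fin.snoc q 0 : Pd (n + 1)) ∈ Cu))), yProfile (univ.filter fun q : Pd n => (Fin.snoc q 0 : Pd (n + 1)) ∈ Au) (univ.filter fun q : Pd n => (Fin.snoc q 2 : Pd (n + 1)) ∈ Bu)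 y := sStarD_eq_sum_yProfile _ _ _
    have eL : sStarD (univ.filter fun q : Pd n => (Fin.snoc q 0 : Pd (n + 1)) ∈ Au) (univ.filter fun q : Pd n => (Fin.snoc q 2 : Pd (n + 1)) ∈ Bu) (univ.filter fun q : Pd n => (Fin.snoc q 2 : Pd (n + 1)) ∈ Cu) = (∑ y ∈ (univ.filter fun q : Pd n => (Fin.snoc q 2 : Pd (n + 1)) ∈ Cu) \ Uc, yProfile (univ.filter fun q : Pd n => (Fin.snoc q 0 : Pd (n + 1)) ∈ Au) (univ.filter fun q : Pd n => (Fin.snoc q 2 : Pd (n + 1)) ∈ Bu) y) + ∑ y ∈ Uc, yProfile (univ.filter fun q : Pd n => (Fin.snoc q 0 : Pd (n + 1)) ∈ Au) (univ.filter fun q : Pd n => (Fin.snoc q 2 : Pd (n + 1)) ∈ Bu) y := by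
      rw [sStarD_eq_sum_yProfile, ← Finset.sum_sdiff hUc]
    have eU : sStarD (univ.filter fun q : Pd n => (Fin.snoc q 0 : Pd (n + 1)) ∈ Au) (univ.filter fun q : Pd n => (Fin.snoc q 2 : Pd (n + 1)) ∈ Bu) Uc = ∑ y ∈ Uc, yProfile (univ.filter fun q : Pd n => (Fin.snoc q 0 : Pd (n + 1)) ∈ Au) (univ.filter fun q : Pd n => (Fin.snoc q 2 : Pd (n + 1)) ∈ Bu) y := sStarD_eq_sum_yProfile _ _ _
    have hle := Finset.sum_le_sum_of_subset_of_nonneg hsub (f := fun y => yProfile (univ.filter fun q : Pd n => (Fin.snoc q 0 : Pd (n + 1)) ∈ Au) (univ.filter fun q : Pd n => (Fin.snoc q 2 : Pd (n + 1)) ∈ Bu) y)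
      (fun y hy _ => yProfile_nonneg_of_mem (hshC y (mem_sdiff.1 hy).1 (mem_sdiff.1 hy).2))
    linarith
  linarith [hR, cb, cc, h1, h2]

/-- Removing a set of MINIMAL elements from an up-set leaves an up-set. [this work] -/
theorem isUpperSet_sdiff_of_minimal {S T : Finset (Pd n)} (hS : IsUpperSet (S : Set (Pd n)))
    (hmin : ∀ q ∈ T, ∀ p ∈ S, p ≤ q → p = q) : IsUpperSet ((S \ T : Finset (Pd n)) : Set (Pd n)) := by
  intro x y hxy hx
  rw [Finset.mem_coe, mem_sdiff] at hx ⊢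
  refine ⟨hS hxy hx.1, fun hy => hx.2 ?_⟩
  have := hmin y hy x hx.1 hxy
  rw [this]; exact hy

/-- **THEOREM M** (every `n`): COMB-M⁺ `2·sStarD τ ≤ sStarD υ` for an upper-step triple of up-sets, given the nonnegativity of the two `n`-dimensional
functionals `sStarD(A²,C²,B²∖T_b)` and `sStarD(A⁰,B²,C²∖T_c)` — instances of `PatternPos n` as soon as `B²∖T_b` and `C²∖T_c` are up-sets, which is the
case when every cost point of `T_b` is a MINIMAL element of `B²` and every point of `T_c` is minimal in `C²` (`isUpperSet_sdiff_of_minimal`): "a cost point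
that is minimal in its lowered top is paid by its own term of the y-decomposition". [this work] -/
theorem two_mul_sStarD_top_le_of_upperStep_minimalCosts (Au Bu Cu : Finset (Pd (n + 1)))
    (hA : IsUpperSet (Au : Set (Pd (n + 1)))) (hB : IsUpperSet (Bu : Set (Pd (n + 1)))) (hC : IsUpperSet (Cu : Set (Pd (n + 1))))
    (hAu : ∀ q : Pd n, ind Au (Fin.snoc q 1 : Pd (n + 1)) = ind Au (Fin.snoc q 2 : Pd (n + 1)))
    (hBu : ∀ q : Pd n, ind Bu (Fin.snoc q 1 : Pd (n + 1)) = ind Bu (Fin.snoc q 2 : Pd (n + 1)))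
    (hCu : ∀ q : Pd n, ind Cu (Fin.snoc q 1 : Pd (n + 1)) = ind Cu (Fin.snoc q 2 : Pd (n + 1)))
    (h1 : 0 ≤ sStarD (univ.filter fun q : Pd n => (Fin.snoc q 2 : Pd (n + 1)) ∈ Au) (univ.filter fun q : Pd n => (Fin.snoc q 2 : Pd (n + 1)) ∈ Cu) ((univ.filter fun q : Pd n => (Fin.snoc q 2 : Pd (n + 1)) ∈ Bu) \ (((univ.filter fun q : Pd n => (Fin.snoc q 0 : Pd (n + 1)) ∈ Au) ∩ ((univ.filter fun q : Pd n => (Fin.snoc q 2 : Pd (n + 1)) ∈ Bu) \ (univ.filter fun q : Pd n => (Fin.snoc q 0 : Pd (n + 1)) ∈ Bu))) ∩ (univ.filter fun q : Pd n => (Fin.snoc q 2 : Pd (n + 1)) ∈ Cu))))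
    (h2 : 0 ≤ sStarD (univ.filter fun q : Pd n => (Fin.snoc q 0 : Pd (n + 1)) ∈ Au) (univ.filter fun q : Pd n => (Fin.snoc q 2 : Pd (n + 1)) ∈ Bu) ((univ.filter fun q : Pd n => (Fin.snoc q 2 : Pd (n + 1)) ∈ Cu) \ (((univ.filter fun q : Pd n => (Fin.snoc q 0 : Pd (n + 1)) ∈ Au) ∩ (univ.filter fun q : Pd n => (Fin.snoc q 0 : Pd (n + 1)) ∈ Bu)) ∩ ((univ.filter fun q : Pd n => (Fin.snoc q 2 : Pd (n + 1)) ∈ Cu) \ (univ.filter fun q : Pd n => (Fin.snoc q 0 : Pd (n + 1)) ∈ Cu))))) :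
    2 * sStarD (univ.filter fun q : Pd n => (Fin.snoc q 2 : Pd (n + 1)) ∈ Au) (univ.filter fun q : Pd n => (Fin.snoc q 2 : Pd (n + 1)) ∈ Bu) (univ.filter fun q : Pd n => (Fin.snoc q 2 : Pd (n + 1)) ∈ Cu) ≤ sStarD Au Bu Cu := by
  have sA : (univ.filter fun q : Pd n => (Fin.snoc q 0 : Pd (n + 1)) ∈ Au) ⊆ (univ.filter fun q : Pd n => (Fin.snoc q 2 : Pd (n + 1)) ∈ Au) := by
    intro q hq
    rw [mem_filter] at hq ⊢
    exact ⟨mem_univ _, hA (snoc_le_snoc_of_le q (by decide : (0:Fin 3) ≤ 2)) hq.2⟩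
  have sB : (univ.filter fun q : Pd n => (Fin.snoc q 0 : Pd (n + 1)) ∈ Bu) ⊆ (univ.filter fun q : Pd n => (Fin.snoc q 2 : Pd (n + 1)) ∈ Bu) := by
    intro q hq
    rw [mem_filter] at hq ⊢
    exact ⟨mem_univ _, hB (snoc_le_snoc_of_le q (by decide : (0:Fin 3) ≤ 2)) hq.2⟩
  refine two_mul_sStarD_top_le_of_upperStep_shadow Au Bu Cu ((univ.filter fun q : Pd n => (Fin.snoc q 2 : Pd (n + 1)) ∈ Bu) \ (((univ.filter fun q : Pd n => (Fin.snoc q 0 : Pd (n + 1)) ∈ Au) ∩ ((univ.filter fun q : Pd n => (Fin.snoc q 2 : Pd (n + 1)) ∈ Bu) \ (univ.filter fun q : Pd n => (Fin.snoc q 0 : Pd (n + 1)) ∈ Bu))) ∩ (univ.filter fun q : Pd n => (Fin.snoc q 2 : Pd (n + 1)) ∈ Cu))) ((univ.filter fun q : Pd n => (Fin.snoc q 2 : Pd (n + 1)) ∈ Cu) \ (((univ.filter fun q : Pd n => (Fin.snoc q 0 : Pd (n + 1)) ∈ Au) ∩ (univ.filter fun q : Pd n => (Fin.snoc q 0 :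 Pd (n + 1)) ∈ Bu)) ∩ ((univ.filter fun q : Pd n => (Fin.snoc q 2 : Pd (n + 1)) ∈ Cu) \ (univ.filter fun q : Pd n => (Fin.snoc q 0 : Pd (n + 1)) ∈ Cu)))) hA hB hC hAu hBu hCu
    sdiff_subset sdiff_subset (fun q hq h => (mem_sdiff.1 h).2 hq) (fun q hq h => (mem_sdiff.1 h).2 hq) ?_ ?_ h1 h2
  · intro q hqB hq
    have hT : q ∈ (((univ.filter fun q : Pd n => (Fin.snoc q 0 : Pd (n + 1)) ∈ Au) ∩ ((univ.filter fun q : Pd n => (Fin.snoc q 2 : Pd (n + 1)) ∈ Bu) \ (univ.filter fun q : Pd n => (Fin.snoc q 0 : Pd (n + 1)) ∈ Bu))) ∩ (univ.filter fun q : Pd n => (Fin.snoc q 2 : Pd (n + 1)) ∈ Cu)) := by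
      by_contra hT; exact hq (mem_sdiff.2 ⟨hqB, hT⟩)
    exact mem_inter.2 ⟨sA (mem_inter.1 (mem_inter.1 hT).1).1, (mem_inter.1 hT).2⟩
  · intro q hqC hq
    have hT : q ∈ (((univ.filter fun q : Pd n => (Fin.snoc q 0 : Pd (n + 1)) ∈ Au) ∩ (univ.filter fun q : Pd n => (Fin.snoc q 0 : Pd (n + 1)) ∈ Bu)) ∩ ((univ.filter fun q : Pd n => (Fin.snoc q 2 : Pd (n + 1)) ∈ Cu) \ (univ.filter fun q : Pd n => (Fin.snoc q 0 : Pd (n + 1)) ∈ Cu))) := by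
      by_contra hT; exact hq (mem_sdiff.2 ⟨hqC, hT⟩)
    exact mem_inter.2 ⟨(mem_inter.1 (mem_inter.1 hT).1).1, sB (mem_inter.1 (mem_inter.1 hT).1).2⟩

end Summit.CriticalPhenomena.PercolationContinuityZ3.Theorems.SahiGridPattern
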